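import Literature.NumberTheory.Sieve.PairShiuClassI
import HarnessLib

/-!
# The bivariate Shiu bound: class IV

Topic `Literature/NumberTheory/Sieve`. Everything here is PROVED; no definition is introduced.
Class IV of Shiu's method (J. reine angew. Math. 313 (1980), §5, `∑_{IV}`) for the pair of linear
forms `(n, mn + h)` (level `z = w²`): the `n` with `c = c₁c₂ > w`, an intermediate cut prime
`L₀ < P_n ≤ w`, and `h`-parts of `n`, `mn + h` at most `Y`. At level `r = ⌊log z / log P_n⌋`
the cofactors are sifted to `u = z^{1/(r+1)}` and carry `f(d₁)g(d₂) ≤ B^{2(r+1)M₁}`; the parts of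
`c₁, c₂` coprime to `h` are summed with Rankin's trick at the uniform exponent
`η = K₁ r / log z` (`K₁ = 8M₁ log B + 8 log 2`), which saves `e^{-K₁ r/4} = B^{-2rM₁} 4^{-r}`
against the product `u₁u₂ > w/Y² ≥ w^{1/2}` (`Y ≤ w^{1/4}`); the `h`-parts are summed with `PairShiuLocal.sum_pairs_le`.

## References

* P. Shiu, J. reine angew. Math. 313 (1980), 161–170, §5 and Lemma 3. [cite: Shiu1980, §5]
* K. Matomäki, J. Merikoski, IMRN 2023 (arXiv:2112.11412), Lemma 3.1. [cite: MatomakiMerikoski2023, Lemma 3.1]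

(Build note 2026-08-15: file re-submitted unchanged in content to trigger a rebuild of its compiled artefact.)
-/

noncomputable section

open Finset Real

namespace Literature.NumberTheory.Sieve

namespace PairShiu

/-! ### Auxiliary estimates -/

/-- The real-variable bookkeeping of one class-IV fibre: the junk terms are absorbed into the
Rankin weight `W = f̂(c₁)ĝ(c₂)Ge/(c₁c₂)` using `c₁c₂ ≤ z` and `Ge ≥ 1`. [folklore] -/
theorem fibre_algebra_rankin {fc gc ψ1 ψ2 ψh ψm V N G Ge c1 c2 corr cnt C₀ W19 z BM : ℝ}
    (hfc : 0 ≤ fc) (hgc : 0 ≤ gc) (hψ1 : 1 ≤ ψ1) (hψ2 : 1 ≤ ψ2) (hψh : 0 ≤ ψh) (hψm : 0 ≤ ψm)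
    (hV0 : 0 ≤ V) (hV1 : V ≤ 1) (hN : 0 ≤ N) (hG0 : 0 ≤ G) (hGe : G ≤ Ge) (hGe1 : 1 ≤ Ge)
    (hc1 : 0 < c1) (hc2 : 0 < c2) (hcz : c1 * c2 ≤ z)
    (hcorr0 : 0 ≤ corr) (hcorr : corr ≤ ψh * ψm * ψ1 * ψ2) (hC₀ : 0 ≤ C₀) (hW : 0 ≤ W19)
    (hcnt : cnt ≤ C₀ * (N * G / (c1 * c2) + 1) * (V * corr) + C₀ * W19) (hBM : 0 ≤ BM) :
    fc * gc * BM * cnt ≤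
      C₀ * BM * (N * V * ψh * ψm + z * (ψh * ψm + W19)) * (fc * ψ1 * (gc * ψ2) * Ge / (c1 * c2)) := by
  set W : ℝ := fc * ψ1 * (gc * ψ2) * Ge / (c1 * c2) with hWdef
  have hGe0 : 0 ≤ Ge := hG0.trans hGe
  have hfh0 : 0 ≤ fc * ψ1 := by positivity
  have hgh0 : 0 ≤ gc * ψ2 := by positivity
  have hW0 : 0 ≤ W := by positivity
  -- `f̂ĝ ≤ W z`
  have hkey : fc * ψ1 * (gc * ψ2) ≤ W * z := by
    rw [hWdef, div_mul_eq_mul_div, le_div_iff₀ (by positivity)]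
    calc fc * ψ1 * (gc * ψ2) * (c1 * c2) ≤ fc * ψ1 * (gc * ψ2) * z :=
          mul_le_mul_of_nonneg_left hcz (by positivity)
      _ = fc * ψ1 * (gc * ψ2) * 1 * z := by ring
      _ ≤ fc * ψ1 * (gc * ψ2) * Ge * z := by
          refine mul_le_mul_of_nonneg_right (mul_le_mul_of_nonneg_left hGe1 (by positivity)) ?_
          nlinarith
  have hfg_le : fc * gc ≤ fc * ψ1 * (gc * ψ2) := by
    have h1 : fc ≤ fc * ψ1 := le_mul_of_one_le_right hfc hψ1
    have h2 : gc ≤ gc * ψ2 := le_mul_of_one_le_right hgc hψ2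
    exact mul_le_mul h1 h2 hgc (by positivity)
  -- replace `cnt`
  have hcnt' : cnt ≤ C₀ * (N * Ge / (c1 * c2) + 1) * (V * (ψh * ψm * ψ1 * ψ2)) + C₀ * W19 := by
    refine hcnt.trans (add_le_add ?_ le_rfl)
    have h1 : N * G / (c1 * c2) + 1 ≤ N * Ge / (c1 * c2) + 1 := by gcongr
    exact mul_le_mul (mul_le_mul_of_nonneg_left h1 hC₀) (mul_le_mul_of_nonneg_left hcorr hV0)
      (mul_nonneg hV0 hcorr0) (by positivity)
  have hstep : fc * gc * BM * cnt ≤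
      fc * gc * BM * (C₀ * (N * Ge / (c1 * c2) + 1) * (V * (ψh * ψm * ψ1 * ψ2)) + C₀ * W19) :=
    mul_le_mul_of_nonneg_left hcnt' (by positivity)
  refine hstep.trans ?_
  have hpiece1 : fc * gc * (N * Ge / (c1 * c2)) * (V * (ψh * ψm * ψ1 * ψ2)) = N * V * ψh * ψm * W := by
    rw [hWdef]; field_simp
  have hpiece2 : fc * gc * (V * (ψh * ψm * ψ1 * ψ2)) ≤ z * (ψh * ψm) * W := by
    calc fc * gc * (V * (ψh * ψm * ψ1 * ψ2)) = V * (ψh * ψm) * (fc * ψ1 * (gc * ψ2)) := by ring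
      _ ≤ 1 * (ψh * ψm) * (W * z) :=
          mul_le_mul (mul_le_mul_of_nonneg_right hV1 (by positivity)) hkey (by positivity) (by positivity)
      _ = z * (ψh * ψm) * W := by ring
  have hpiece3 : fc * gc * W19 ≤ z * W19 * W := by
    calc fc * gc * W19 ≤ (W * z) * W19 := mul_le_mul_of_nonneg_right (hfg_le.trans hkey) hW
      _ = z * W19 * W := by ring
  have hBC : 0 ≤ C₀ * BM := mul_nonneg hC₀ hBM
  calc fc * gc * BM * (C₀ * (N * Ge / (c1 * c2) + 1) * (V * (ψh * ψm * ψ1 * ψ2)) + C₀ * W19)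
      = C₀ * BM * (fc * gc * (N * Ge / (c1 * c2)) * (V * (ψh * ψm * ψ1 * ψ2)) +
          fc * gc * (V * (ψh * ψm * ψ1 * ψ2)) + fc * gc * W19) := by ring
    _ ≤ C₀ * BM * (N * V * ψh * ψm * W + z * (ψh * ψm) * W + z * W19 * W) := by
        rw [hpiece1]
        exact mul_le_mul_of_nonneg_left (add_le_add (add_le_add le_rfl hpiece2) hpiece3) hBC
    _ = _ := by rw [hWdef]; ring

/-- **Shiu's Euler majorant with a Rankin exponent, packaged**: for `F ≥ 0` multiplicative on
coprime arguments with `F 1 = 1`, `F(p^l) ≤ B'^l`, `F(n) ≤ A n^{1/6}`, `0 ≤ η ≤ 1/6`, `v ≥ 2` and a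
finite set `S` of positive integers all of whose prime factors are `< v`:
`∑_{c ∈ S} F(c) c^{η−1} ≤ exp(∑_{p < v} F(p)/p + B' η v^η (log v + log 4) + K₅(A,B'))`.
[cite: Shiu1980, Lemma 3] -/
theorem euler_rpow_le {F : ℕ → ℝ} (hF0 : ∀ n, 0 ≤ F n) (hF1 : F 1 = 1)
    (hFmul : ∀ a b : ℕ, a.Coprime b → F (a * b) = F a * F b)
    {B' : ℝ} (hB'1 : 1 ≤ B') (hFB : ∀ p l : ℕ, p.Prime → 1 ≤ l → F (p ^ l) ≤ B' ^ l)
    {A : ℝ} (hFA : ∀ n : ℕ, 1 ≤ n → F n ≤ A * (n : ℝ) ^ (1 / 6 : ℝ))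
    {η : ℝ} (hη0 : 0 ≤ η) (hη : η ≤ 1 / 6) {v : ℝ} (hv : 2 ≤ v)
    {S : Finset ℕ} (hS0 : ∀ c ∈ S, c ≠ 0) (hSv : ∀ c ∈ S, ∀ p ∈ c.primeFactors, (p : ℝ) < v) :
    ∑ c ∈ S, F c * (c : ℝ) ^ (η - 1) ≤
      Real.exp (∑ p ∈ Shiu.primesBelowNotDvd v 1, F p / p +
        B' * η * v ^ η * (Real.log v + Real.log 4) + Shiu.K₅ A B') := by
  set s := Shiu.primesBelowNotDvd v 1 with hs_def
  have hs : ∀ p ∈ s, p.Prime := fun p hp => (Shiu.mem_primesBelowNotDvd.1 hp).1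
  have hfact : ∀ c ∈ S, c ∈ Nat.factoredNumbers s := by
    intro c hc
    rw [Nat.mem_factoredNumbers']
    intro p hp hpc
    rw [hs_def, Shiu.mem_primesBelowNotDvd]
    exact ⟨hp, hSv c hc p (Nat.mem_primeFactors.2 ⟨hp, hpc, hS0 c hc⟩),
      fun h1 => hp.one_lt.ne' (Nat.dvd_one.mp h1)⟩
  have h2 := Shiu.euler_majorant hF0 hF1 hFmul hB'1 hFB hFA hη hs hfact
  have hv1 : 1 ≤ v := by linarith
  have h3 := Shiu.sum_rpow_le_sum_div_add (f := F) hs hv1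
    (fun p hp => (Shiu.mem_primesBelowNotDvd.1 hp).2.1.le) (by linarith : (0 : ℝ) ≤ B')
    (fun p hp => by
      have := hFB p 1 (hs p hp) le_rfl
      rwa [pow_one, pow_one] at this) hη0
  refine h2.trans (Real.exp_le_exp.2 ?_)
  linarith


/-- **The main sum of class IV, with Rankin's trick on the parts coprime to `h`.** As
`PairShiu.mainSum_le`, for pairs `(c₁, c₂)` with `1 ≤ cᵢ ≤ z`, all prime factors `< v`, coupled at
the primes of `h`, and with `u₁u₂ > W₀` (`uᵢ = cᵢ / h(cᵢ)`): for `0 ≤ η ≤ 1/6`,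
`∑_T f̂(c₁)ĝ(c₂)(h(c₁),h(c₂))/(c₁c₂) ≤ W₀^{-η} e^{160Â'²}∏_{p∣h}(1+f̂(p)ĝ(p)/p) · M_f̂ M_ĝ`,
`M_F = exp(∑_{p<v} F(p)/p + B'ηv^η(log v + log 4) + K₅(A,B'))`.
[cite: Shiu1980, Lemma 3] [cite: MatomakiMerikoski2023, Lemma 3.1] -/
theorem mainSum_rankin_le {fh gh : ℕ → ℝ} (hfh0 : ∀ n, 0 ≤ fh n) (hgh0 : ∀ n, 0 ≤ gh n)
    (hfh1 : fh 1 = 1) (hgh1 : gh 1 = 1)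
    (hfhmul : ∀ a b : ℕ, a.Coprime b → fh (a * b) = fh a * fh b)
    (hghmul : ∀ a b : ℕ, a.Coprime b → gh (a * b) = gh a * gh b)
    {B' : ℝ} (hB'1 : 1 ≤ B') (hfhB : ∀ p l : ℕ, p.Prime → 1 ≤ l → fh (p ^ l) ≤ B' ^ l)
    (hghB : ∀ p l : ℕ, p.Prime → 1 ≤ l → gh (p ^ l) ≤ B' ^ l)
    {A : ℝ} (hfhA : ∀ n : ℕ, 1 ≤ n → fh n ≤ A * (n : ℝ) ^ (1 / 6 : ℝ))
    (hghA : ∀ n : ℕ, 1 ≤ n → gh n ≤ A * (n : ℝ) ^ (1 / 6 : ℝ))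
    {Â' : ℝ} (hÂ' : 0 ≤ Â') (hfhÂ : ∀ p a : ℕ, p.Prime → 1 ≤ a → fh (p ^ a) ≤ Â' * ((p : ℝ) ^ a) ^ (1 / 8 : ℝ))
    (hghÂ : ∀ p a : ℕ, p.Prime → 1 ≤ a → gh (p ^ a) ≤ Â' * ((p : ℝ) ^ a) ^ (1 / 8 : ℝ))
    {h : ℕ} (hh : h ≠ 0) {η : ℝ} (hη0 : 0 ≤ η) (hη : η ≤ 1 / 6) {v : ℝ} (hv : 2 ≤ v)
    {W₀ : ℝ} (hW₀ : 0 < W₀) (T : Finset (ℕ × ℕ))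
    (hT : ∀ c ∈ T, 1 ≤ c.1 ∧ 1 ≤ c.2 ∧
      (∀ p ∈ h.primeFactors, c.1.factorization p = 0 ↔ c.2.factorization p = 0) ∧
      (∀ p ∈ c.1.primeFactors, (p : ℝ) < v) ∧ (∀ p ∈ c.2.primeFactors, (p : ℝ) < v) ∧
      W₀ < ((c.1 / ∏ q ∈ h.primeFactors, q ^ c.1.factorization q : ℕ) : ℝ) *
        ((c.2 / ∏ q ∈ h.primeFactors, q ^ c.2.factorization q : ℕ) : ℝ)) :
    ∑ c ∈ T, fh c.1 * gh c.2 *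
        (Nat.gcd (∏ q ∈ h.primeFactors, q ^ c.1.factorization q)
          (∏ q ∈ h.primeFactors, q ^ c.2.factorization q) : ℝ) / ((c.1 : ℝ) * c.2) ≤
      W₀ ^ (-η) * ((Real.exp (160 * Â' ^ 2) * ∏ p ∈ h.primeFactors, (1 + fh p * gh p / p)) *
        (Real.exp (∑ p ∈ Shiu.primesBelowNotDvd v 1, fh p / p +
            B' * η * v ^ η * (Real.log v + Real.log 4) + Shiu.K₅ A B') *
          Real.exp (∑ p ∈ Shiu.primesBelowNotDvd v 1, gh p / p +
            B' * η * v ^ η * (Real.log v + Real.log 4) + Shiu.K₅ A B'))) := by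
  classical
  set hP : ℕ → ℕ := fun k => ∏ q ∈ h.primeFactors, q ^ k.factorization q with hhP
  set eM : ℕ × ℕ → ℕ × ℕ := fun c => (hP c.1, hP c.2) with heM
  set u₁ : ℕ × ℕ → ℕ := fun c => c.1 / hP c.1 with hu₁
  set u₂ : ℕ × ℕ → ℕ := fun c => c.2 / hP c.2 with hu₂
  set Aw : ℕ × ℕ → ℝ := fun e => fh e.1 * gh e.2 * (Nat.gcd e.1 e.2 : ℝ) / ((e.1 : ℝ) * e.2) with hAw
  set F₁ : ℕ → ℝ := fun u => fh u * (u : ℝ) ^ (η - 1) with hF₁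
  set F₂ : ℕ → ℝ := fun u => gh u * (u : ℝ) ^ (η - 1) with hF₂
  set E := T.image eM with hE
  -- the set of cofactors
  set U₀ := (T.image u₁) ∪ (T.image u₂) with hU₀
  -- termwise bound
  have hterm : ∀ c ∈ T, fh c.1 * gh c.2 * (Nat.gcd (hP c.1) (hP c.2) : ℝ) / ((c.1 : ℝ) * c.2) ≤
      W₀ ^ (-η) * (Aw (eM c) * F₁ (u₁ c) * F₂ (u₂ c)) := by
    intro c hc
    obtain ⟨hc1, hc2, -, -, -, hW⟩ := hT c hc
    have hc10 : c.1 ≠ 0 := by omega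
    have hc20 : c.2 ≠ 0 := by omega
    have hd1 : hP c.1 * u₁ c = c.1 := hPart_mul_div hc10 h
    have hd2 : hP c.2 * u₂ c = c.2 := hPart_mul_div hc20 h
    have hcop1 : (hP c.1).Coprime (u₁ c) := coprime_hPart_div hc10 hh
    have hcop2 : (hP c.2).Coprime (u₂ c) := coprime_hPart_div hc20 hh
    have hf : fh c.1 = fh (hP c.1) * fh (u₁ c) := by
      conv_lhs => rw [← hd1]
      exact hfhmul _ _ hcop1
    have hg : gh c.2 = gh (hP c.2) * gh (u₂ c) := by
      conv_lhs => rw [← hd2]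
      exact hghmul _ _ hcop2
    have hc1r : (c.1 : ℝ) = (hP c.1 : ℝ) * (u₁ c : ℝ) := by
      rw [← Nat.cast_mul]; exact_mod_cast hd1.symm
    have hc2r : (c.2 : ℝ) = (hP c.2 : ℝ) * (u₂ c : ℝ) := by
      rw [← Nat.cast_mul]; exact_mod_cast hd2.symm
    have he1 : (0 : ℝ) < hP c.1 := by exact_mod_cast Nat.pos_of_ne_zero (hPart_ne_zero h _)
    have he2 : (0 : ℝ) < hP c.2 := by exact_mod_cast Nat.pos_of_ne_zero (hPart_ne_zero h _)
    have hu1 : (0 : ℝ) < u₁ c := by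
      have : u₁ c ≠ 0 := fun h0 => hc10 (by rw [← hd1, h0, mul_zero])
      exact_mod_cast Nat.pos_of_ne_zero this
    have hu2 : (0 : ℝ) < u₂ c := by
      have : u₂ c ≠ 0 := fun h0 => hc20 (by rw [← hd2, h0, mul_zero])
      exact_mod_cast Nat.pos_of_ne_zero this
    have hW' : W₀ < (u₁ c : ℝ) * (u₂ c : ℝ) := hW
    -- the identity `W(c) = Aw · (fh u₁/u₁)(gh u₂/u₂)`
    have hid : fh c.1 * gh c.2 * (Nat.gcd (hP c.1) (hP c.2) : ℝ) / ((c.1 : ℝ) * c.2) =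
        Aw (eM c) * (fh (u₁ c) * gh (u₂ c) * ((u₁ c : ℝ) * (u₂ c))⁻¹) := by
      simp only [hAw, heM]
      rw [hf, hg, hc1r, hc2r]
      field_simp
    rw [hid]
    -- Rankin: `(u₁u₂)⁻¹ ≤ W₀^{-η} (u₁u₂)^{η-1}`
    have hprod0 : (0 : ℝ) < (u₁ c : ℝ) * (u₂ c) := mul_pos hu1 hu2
    have hrank : ((u₁ c : ℝ) * (u₂ c))⁻¹ ≤ W₀ ^ (-η) * (((u₁ c : ℝ)) ^ (η - 1) * ((u₂ c : ℝ)) ^ (η - 1)) := by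
      rw [← Real.mul_rpow hu1.le hu2.le]
      have heq : ((u₁ c : ℝ) * (u₂ c))⁻¹ = ((u₁ c : ℝ) * (u₂ c)) ^ (-η) * ((u₁ c : ℝ) * (u₂ c)) ^ (η - 1) := by
        rw [← Real.rpow_add hprod0, ← Real.rpow_neg_one]
        congr 1; ring
      rw [heq]
      refine mul_le_mul_of_nonneg_right ?_ (by positivity)
      exact Real.rpow_le_rpow_of_nonpos hW₀ hW'.le (by linarith)
    have hA0 : 0 ≤ Aw (eM c) := by simp only [hAw]; have := hfh0 (eM c).1; have := hgh0 (eM c).2; positivity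
    calc Aw (eM c) * (fh (u₁ c) * gh (u₂ c) * ((u₁ c : ℝ) * (u₂ c))⁻¹)
        ≤ Aw (eM c) * (fh (u₁ c) * gh (u₂ c) * (W₀ ^ (-η) * (((u₁ c : ℝ)) ^ (η - 1) * ((u₂ c : ℝ)) ^ (η - 1)))) := by
          refine mul_le_mul_of_nonneg_left (mul_le_mul_of_nonneg_left hrank ?_) hA0
          exact mul_nonneg (hfh0 _) (hgh0 _)
      _ = W₀ ^ (-η) * (Aw (eM c) * F₁ (u₁ c) * F₂ (u₂ c)) := by simp only [hF₁, hF₂]; ring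
  refine (Finset.sum_le_sum hterm).trans ?_
  rw [← Finset.mul_sum]
  refine mul_le_mul_of_nonneg_left ?_ (by positivity)
  -- the triple product over `U₀`
  have hU₀facts : ∀ u ∈ U₀, u ≠ 0 ∧ ∀ p ∈ u.primeFactors, (p : ℝ) < v := by
    intro u hu
    rw [hU₀, Finset.mem_union, Finset.mem_image, Finset.mem_image] at hu
    rcases hu with ⟨c, hc, rfl⟩ | ⟨c, hc, rfl⟩
    · obtain ⟨hc1, -, -, hv1, -, -⟩ := hT c hc
      have hc10 : c.1 ≠ 0 := by omega
      have hd1 : hP c.1 * u₁ c = c.1 := hPart_mul_div hc10 h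
      refine ⟨fun h0 => hc10 (by rw [← hd1, h0, mul_zero]), fun p hp => hv1 p ?_⟩
      exact Nat.primeFactors_mono ⟨hP c.1, by rw [mul_comm]; exact hd1.symm⟩ hc10 hp
    · obtain ⟨-, hc2, -, -, hv2, -⟩ := hT c hc
      have hc20 : c.2 ≠ 0 := by omega
      have hd2 : hP c.2 * u₂ c = c.2 := hPart_mul_div hc20 h
      refine ⟨fun h0 => hc20 (by rw [← hd2, h0, mul_zero]), fun p hp => hv2 p ?_⟩
      exact Nat.primeFactors_mono ⟨hP c.2, by rw [mul_comm]; exact hd2.symm⟩ hc20 hp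
  have h3 := sum_le_prod_three (T := T) (E := E) (U := U₀) eM u₁ u₂ Aw F₁ F₂
    (fun e _ => by simp only [hAw]; have := hfh0 e.1; have := hgh0 e.2; positivity)
    (fun u _ => by simp only [hF₁]; have := hfh0 u; positivity)
    (fun u _ => by simp only [hF₂]; have := hgh0 u; positivity) ?_ ?_
  rotate_left
  · intro c hc
    refine ⟨Finset.mem_image_of_mem eM hc, ?_, ?_⟩
    · rw [hU₀]; exact Finset.mem_union_left _ (Finset.mem_image_of_mem u₁ hc)
    · rw [hU₀]; exact Finset.mem_union_right _ (Finset.mem_image_of_mem u₂ hc)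
  · intro c hc c' hc' heq
    simp only [Prod.mk.injEq, heM] at heq
    obtain ⟨⟨h11, h12⟩, h21, h22⟩ := heq
    obtain ⟨hc1, hc2, -⟩ := hT c hc
    obtain ⟨hc1', hc2', -⟩ := hT c' hc'
    have hd1 : hP c.1 * u₁ c = c.1 := hPart_mul_div (show c.1 ≠ 0 by omega) h
    have hd1' : hP c'.1 * u₁ c' = c'.1 := hPart_mul_div (show c'.1 ≠ 0 by omega) h
    have hd2 : hP c.2 * u₂ c = c.2 := hPart_mul_div (show c.2 ≠ 0 by omega) h
    have hd2' : hP c'.2 * u₂ c' = c'.2 := hPart_mul_div (show c'.2 ≠ 0 by omega) h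
    have e1 : c.1 = c'.1 := by rw [← hd1, ← hd1', h11, h21]
    have e2 : c.2 = c'.2 := by rw [← hd2, ← hd2', h12, h22]
    exact Prod.ext e1 e2
  refine h3.trans ?_
  -- the three factors
  have hE : ∑ e ∈ E, Aw e ≤ Real.exp (160 * Â' ^ 2) * ∏ p ∈ h.primeFactors, (1 + fh p * gh p / p) := by
    have := PairShiuLocal.sum_pairs_le hfh0 hgh0 hfh1 hgh1 hfhmul hghmul hÂ' hfhÂ hghÂ h E ?_ ?_ ?_
    · simpa only [hAw] using this
    · intro e he
      rw [hE, Finset.mem_image] at he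
      obtain ⟨c, -, rfl⟩ := he
      exact ⟨hPart_ne_zero h _, hPart_ne_zero h _⟩
    · intro e he
      rw [hE, Finset.mem_image] at he
      obtain ⟨c, -, rfl⟩ := he
      exact ⟨primeFactors_hPart_subset h _, primeFactors_hPart_subset h _⟩
    · intro e he p
      rw [hE, Finset.mem_image] at he
      obtain ⟨c, hc, rfl⟩ := he
      obtain ⟨-, -, hcouple, -⟩ := hT c hc
      simp only [heM, hhP]
      rw [factorization_hPart, factorization_hPart]
      by_cases hp : p ∈ h.primeFactors
      · rw [if_pos hp, if_pos hp]; exact hcouple p hp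
      · rw [if_neg hp, if_neg hp]
  have hU1 : ∑ u ∈ U₀, F₁ u ≤ Real.exp (∑ p ∈ Shiu.primesBelowNotDvd v 1, fh p / p +
      B' * η * v ^ η * (Real.log v + Real.log 4) + Shiu.K₅ A B') :=
    euler_rpow_le hfh0 hfh1 hfhmul hB'1 hfhB hfhA hη0 hη hv (fun u hu => (hU₀facts u hu).1)
      (fun u hu => (hU₀facts u hu).2)
  have hU2 : ∑ u ∈ U₀, F₂ u ≤ Real.exp (∑ p ∈ Shiu.primesBelowNotDvd v 1, gh p / p +
      B' * η * v ^ η * (Real.log v + Real.log 4) + Shiu.K₅ A B') :=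
    euler_rpow_le hgh0 hgh1 hghmul hB'1 hghB hghA hη0 hη hv (fun u hu => (hU₀facts u hu).1)
      (fun u hu => (hU₀facts u hu).2)
  have hE0 : 0 ≤ ∑ e ∈ E, Aw e := Finset.sum_nonneg fun e _ => by
    simp only [hAw]; have := hfh0 e.1; have := hgh0 e.2; positivity
  have hU10 : 0 ≤ ∑ u ∈ U₀, F₁ u := Finset.sum_nonneg fun u _ => by simp only [hF₁]; have := hfh0 u; positivity
  have hU20 : 0 ≤ ∑ u ∈ U₀, F₂ u := Finset.sum_nonneg fun u _ => by simp only [hF₂]; have := hgh0 u; positivity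
  calc (∑ e ∈ E, Aw e) * (∑ u ∈ U₀, F₁ u) * (∑ u ∈ U₀, F₂ u)
      ≤ (Real.exp (160 * Â' ^ 2) * ∏ p ∈ h.primeFactors, (1 + fh p * gh p / p)) *
        Real.exp (∑ p ∈ Shiu.primesBelowNotDvd v 1, fh p / p +
            B' * η * v ^ η * (Real.log v + Real.log 4) + Shiu.K₅ A B') *
        Real.exp (∑ p ∈ Shiu.primesBelowNotDvd v 1, gh p / p +
            B' * η * v ^ η * (Real.log v + Real.log 4) + Shiu.K₅ A B') := by
        refine mul_le_mul (mul_le_mul hE hU1 hU10 (hE0.trans hE)) hU2 hU20 ?_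
        exact mul_nonneg (hE0.trans hE) (hU10.trans hU1)
    _ = _ := by ring

/-- `(r + 1)² ≤ 3 · 2^r`. [folklore] -/
theorem succ_sq_le (r : ℕ) : ((r : ℝ) + 1) ^ 2 ≤ 3 * 2 ^ r := by
  have key : ∀ r : ℕ, (r + 1) ^ 2 ≤ 3 * 2 ^ r := by
    intro r
    induction r with
    | zero => norm_num
    | succ k ih =>
      rcases lt_or_ge k 2 with hk | hk
      · interval_cases k <;> norm_num
      · have hk2 : (k + 2) ^ 2 ≤ 2 * (k + 1) ^ 2 := by nlinarith
        calc (k + 1 + 1) ^ 2 = (k + 2) ^ 2 := by ring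
          _ ≤ 2 * (k + 1) ^ 2 := hk2
          _ ≤ 2 * (3 * 2 ^ k) := by omega
          _ = 3 * 2 ^ (k + 1) := by ring
  exact_mod_cast key r

/-! ### Class IV at level `r` -/

set_option maxHeartbeats 1600000 in
/-- **Class IV at level `r`** (Shiu's `∑_{IV}` for `Q(n) = n(mn+h)`, `z = w²`): the `n ≤ N` with
`Q(n) > z`, `c > w`, `L₀ < P_n ≤ w`, `h`-parts of `n` and `mn + h` at most `Y`, and
`⌊log z / log P_n⌋ = r`. With `u = z^{1/(r+1)}`, `K₁ = 8M₁ log B + 8 log 2`, `6K₁ ≤ log L₀`,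
`Y ≤ w^{1/4}`: `∑ f(n)g(mn+h) ≤ C₀ (B^{2M₁}/4^r) (N V(u) ψ(h)ψ(m) + z(ψ(h)ψ(m) + u^{19} log² u)) ·
e^{640Â²}∏_{p∣h}(1+4f(p)g(p)/p) Λ_f Λ_g`,
`Λ_F = exp(∑_{p ≤ z} F̂(p)/p + 2B e^{K₁}(K₁+1) + K₅(A, 2B))`. [cite: Shiu1980, §5 (∑_IV) and Lemma 3] -/
theorem class_IV_r_le : ∃ C : ℝ, 0 < C ∧
    ∀ {f g : ℕ → ℝ}, (∀ n, 0 ≤ f n) → (∀ n, 0 ≤ g n) → f 1 = 1 → g 1 = 1 →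
    (∀ a b : ℕ, a.Coprime b → f (a * b) = f a * f b) →
    (∀ a b : ℕ, a.Coprime b → g (a * b) = g a * g b) →
    ∀ {B : ℝ}, 1 ≤ B → (∀ p l : ℕ, p.Prime → 1 ≤ l → f (p ^ l) ≤ B ^ l) →
    (∀ p l : ℕ, p.Prime → 1 ≤ l → g (p ^ l) ≤ B ^ l) →
    ∀ {A : ℝ}, (∀ n : ℕ, 1 ≤ n →
      f n * (∏ p ∈ n.primeFactors.erase 2, (((p : ℝ) - 1) / ((p : ℝ) - 2))) ≤ A * (n : ℝ) ^ (1 / 6 : ℝ)) →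
    (∀ n : ℕ, 1 ≤ n →
      g n * (∏ p ∈ n.primeFactors.erase 2, (((p : ℝ) - 1) / ((p : ℝ) - 2))) ≤ A * (n : ℝ) ^ (1 / 6 : ℝ)) →
    ∀ {Â : ℝ}, 0 ≤ Â → (∀ p a : ℕ, p.Prime → 1 ≤ a → f (p ^ a) ≤ Â * ((p : ℝ) ^ a) ^ (1 / 8 : ℝ)) →
    (∀ p a : ℕ, p.Prime → 1 ≤ a → g (p ^ a) ≤ Â * ((p : ℝ) ^ a) ^ (1 / 8 : ℝ)) →
    ∀ {m h N : ℕ}, 1 ≤ m → 1 ≤ h → m.Coprime h →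
    ∀ {w L₀ Y : ℝ}, 2 ≤ w → 4 ≤ L₀ → 1 ≤ Y → Y ≤ w ^ (1 / 4 : ℝ) → ∀ {M₁ : ℕ}, Real.log N / Real.log (w * w) ≤ M₁ →
    Real.log ((m * N + h : ℕ) : ℝ) / Real.log (w * w) ≤ M₁ →
    6 * (8 * M₁ * Real.log B + 8 * Real.log 2) ≤ Real.log L₀ → ∀ (r : ℕ),
    ∑ n ∈ (Icc 1 N).filter (fun n : ℕ => w * w < ((n * (m * n + h) : ℕ) : ℝ) ∧
        L₀ < (Shiu.cutPrime (w * w) (n * (m * n + h)) : ℝ) ∧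
        (Shiu.cutPrime (w * w) (n * (m * n + h)) : ℝ) ≤ w ∧
        w < (Shiu.cPart (w * w) (n * (m * n + h)) : ℝ) ∧
        ((∏ q ∈ h.primeFactors, q ^ n.factorization q : ℕ) : ℝ) ≤ Y ∧
        ((∏ q ∈ h.primeFactors, q ^ (m * n + h).factorization q : ℕ) : ℝ) ≤ Y ∧
        ⌊Real.log (w * w) / Real.log (Shiu.cutPrime (w * w) (n * (m * n + h)))⌋₊ = r),
        f n * g (m * n + h) ≤
      C * (B ^ (2 * M₁) / 4 ^ r) *
        ((N : ℝ) * (∏ p ∈ (Nat.primesBelow ⌈(w * w) ^ (1 / ((r : ℝ) + 1))⌉₊).erase 2, (1 - 2 / (p : ℝ))) *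
            (∏ p ∈ h.primeFactors.erase 2, (((p : ℝ) - 1) / ((p : ℝ) - 2))) *
            (∏ p ∈ m.primeFactors.erase 2, (((p : ℝ) - 1) / ((p : ℝ) - 2))) +
          (w * w) * ((∏ p ∈ h.primeFactors.erase 2, (((p : ℝ) - 1) / ((p : ℝ) - 2))) *
            (∏ p ∈ m.primeFactors.erase 2, (((p : ℝ) - 1) / ((p : ℝ) - 2))) +
            ((w * w) ^ (1 / ((r : ℝ) + 1))) ^ (19 : ℕ) * Real.log ((w * w) ^ (1 / ((r : ℝ) + 1))) ^ 2)) *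
        ((Real.exp (640 * Â ^ 2) * ∏ p ∈ h.primeFactors, (1 + 4 * f p * g p / p)) *
          (Real.exp (∑ p ∈ Shiu.primesBelowNotDvd ((⌊w * w⌋₊ : ℝ) + 1) 1,
              f p * (∏ q ∈ p.primeFactors.erase 2, (((q : ℝ) - 1) / ((q : ℝ) - 2))) / p +
              2 * B * Real.exp (8 * M₁ * Real.log B + 8 * Real.log 2) *
                ((8 * M₁ * Real.log B + 8 * Real.log 2) + 1) + Shiu.K₅ A (2 * B)) *
           Real.exp (∑ p ∈ Shiu.primesBelowNotDvd ((⌊w * w⌋₊ : ℝ) + 1) 1,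
              g p * (∏ q ∈ p.primeFactors.erase 2, (((q : ℝ) - 1) / ((q : ℝ) - 2))) / p +
              2 * B * Real.exp (8 * M₁ * Real.log B + 8 * Real.log 2) *
                ((8 * M₁ * Real.log B + 8 * Real.log 2) + 1) + Shiu.K₅ A (2 * B)))) := by
  obtain ⟨C₀, hC₀, hcard⟩ := PairShiuCount.card_le
  refine ⟨C₀, hC₀, ?_⟩
  intro f g hf0 hg0 hf1 hg1 hfmul hgmul B hB1 hfB hgB A hfA hgA Â hÂ hfÂ hgÂ m h N hm hh hmh w L₀ Y hw hL₀ hY hYw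
    M₁ hM₁ hM₂ hLK r
  -- notation
  set ψh : ℝ := ∏ p ∈ h.primeFactors.erase 2, (((p : ℝ) - 1) / ((p : ℝ) - 2)) with hψh
  set ψm : ℝ := ∏ p ∈ m.primeFactors.erase 2, (((p : ℝ) - 1) / ((p : ℝ) - 2)) with hψm
  set ψ : ℕ → ℝ := fun k => ∏ p ∈ k.primeFactors.erase 2, (((p : ℝ) - 1) / ((p : ℝ) - 2)) with hψ
  set fh : ℕ → ℝ := fun n => f n * ψ n with hfh
  set gh : ℕ → ℝ := fun n => g n * ψ n with hgh
  set z : ℝ := w * w with hz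
  set K₁ : ℝ := 8 * M₁ * Real.log B + 8 * Real.log 2 with hK₁
  set u : ℝ := z ^ (1 / ((r : ℝ) + 1)) with hu
  set v : ℝ := z ^ (1 / (r : ℝ)) with hv
  set η : ℝ := K₁ * r / Real.log z with hη
  set PP : ℕ := ∏ p ∈ (Nat.primesBelow ⌈u⌉₊).erase 2, p with hPP
  set V : ℝ := ∏ p ∈ (Nat.primesBelow ⌈u⌉₊).erase 2, (1 - 2 / (p : ℝ)) with hV
  set hP : ℕ → ℕ := fun k => ∏ q ∈ h.primeFactors, q ^ k.factorization q with hhP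
  set S := (Icc 1 N).filter (fun n : ℕ => z < ((n * (m * n + h) : ℕ) : ℝ) ∧
        L₀ < (Shiu.cutPrime z (n * (m * n + h)) : ℝ) ∧
        (Shiu.cutPrime z (n * (m * n + h)) : ℝ) ≤ w ∧
        w < (Shiu.cPart z (n * (m * n + h)) : ℝ) ∧
        ((hP n : ℕ) : ℝ) ≤ Y ∧ ((hP (m * n + h) : ℕ) : ℝ) ≤ Y ∧
        ⌊Real.log z / Real.log (Shiu.cutPrime z (n * (m * n + h)))⌋₊ = r) with hS
  set pr : ℕ → ℕ × ℕ := fun n =>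
    (smoothPart (Shiu.cutPrime z (n * (m * n + h))) n,
     smoothPart (Shiu.cutPrime z (n * (m * n + h))) (m * n + h)) with hpr
  set T := S.image pr with hT
  set Λf : ℝ := Real.exp (∑ p ∈ Shiu.primesBelowNotDvd ((⌊z⌋₊ : ℝ) + 1) 1, f p * ψ p / p +
      2 * B * Real.exp K₁ * (K₁ + 1) + Shiu.K₅ A (2 * B)) with hΛf
  set Λg : ℝ := Real.exp (∑ p ∈ Shiu.primesBelowNotDvd ((⌊z⌋₊ : ℝ) + 1) 1, g p * ψ p / p +
      2 * B * Real.exp K₁ * (K₁ + 1) + Shiu.K₅ A (2 * B)) with hΛg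
  set Δ : ℝ := Real.exp (640 * Â ^ 2) * ∏ p ∈ h.primeFactors, (1 + 4 * f p * g p / p) with hΔ
  -- basic positivity
  have hw0 : 0 < w := by linarith
  have hw1 : 1 < w := by linarith
  have hz4 : 4 ≤ z := by rw [hz]; nlinarith
  have hz1 : 1 ≤ z := by linarith
  have hz0 : 0 < z := by linarith
  have hlogz : 0 < Real.log z := Real.log_pos (by linarith)
  have hlogzw : Real.log z = 2 * Real.log w := by
    rw [hz, Real.log_mul hw0.ne' hw0.ne']; ring
  have hB0 : 0 < B := by linarith
  have hK₁0 : 0 ≤ K₁ := by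
    have := Real.log_nonneg hB1; have := Real.log_pos one_lt_two; positivity
  have hψ1 : ∀ k, 1 ≤ ψ k := fun k => PairShiuLocal.one_le_psi k
  have hψ0 : ∀ k, 0 ≤ ψ k := fun k => PairShiuLocal.psi_nonneg k
  have hΔ0 : 0 ≤ Δ := by
    rw [hΔ]; exact mul_nonneg (Real.exp_pos _).le
      (Finset.prod_nonneg fun p _ => by have := hf0 p; have := hg0 p; positivity)
  have hψh0 : 0 ≤ ψh := hψ0 h
  have hψm0 : 0 ≤ ψm := hψ0 m
  have hψh1 : 1 ≤ ψh := hψ1 h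
  have hψm1 : 1 ≤ ψm := hψ1 m
  have hRHS0 : 0 ≤ C₀ * (B ^ (2 * M₁) / 4 ^ r) *
      ((N : ℝ) * V * ψh * ψm + z * (ψh * ψm + u ^ (19 : ℕ) * Real.log u ^ 2)) *
      (Δ * (Λf * Λg)) := by
    have hV0 : 0 ≤ V := by
      refine Finset.prod_nonneg fun p hp => ?_
      obtain ⟨-, -, hpf, hfacts⟩ := oddProd_facts u
      rw [← hpf] at hp
      obtain ⟨hpp, hp2, -⟩ := hfacts p hp
      have hp3 : (3 : ℝ) ≤ p := by
        exact_mod_cast (Nat.succ_le_of_lt (lt_of_le_of_ne hpp.two_le (Ne.symm hp2)))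
      rw [sub_nonneg, div_le_one (by linarith)]; linarith
    positivity
  -- the empty case
  by_cases hTe : S = ∅
  · rw [hTe, Finset.sum_empty]
    exact hRHS0
  obtain ⟨n₀, hn₀⟩ := Finset.nonempty_iff_ne_empty.2 hTe
  -- facts about the elements of `S` (part 1: the cut)
  have hmem : ∀ n ∈ S, (1 ≤ n ∧ n ≤ N) ∧ z < ((n * (m * n + h) : ℕ) : ℝ) ∧
      L₀ < (Shiu.cutPrime z (n * (m * n + h)) : ℝ) ∧ (Shiu.cutPrime z (n * (m * n + h)) : ℝ) ≤ w ∧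
      w < (Shiu.cPart z (n * (m * n + h)) : ℝ) ∧ ((hP n : ℕ) : ℝ) ≤ Y ∧
      ((hP (m * n + h) : ℕ) : ℝ) ≤ Y ∧ ⌊Real.log z / Real.log (Shiu.cutPrime z (n * (m * n + h)))⌋₊ = r := by
    intro n hn
    rw [hS, Finset.mem_filter, Finset.mem_Icc] at hn
    exact hn
  -- `r ≥ 2`, `r log P ≤ log z < (r+1) log P`, `r log L₀ ≤ log z`
  have hrfacts : ∀ n ∈ S, 2 ≤ r ∧ (r : ℝ) * Real.log (Shiu.cutPrime z (n * (m * n + h))) ≤ Real.log z ∧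
      Real.log z < (r + 1) * Real.log (Shiu.cutPrime z (n * (m * n + h))) ∧
      (r : ℝ) * Real.log L₀ ≤ Real.log z := by
    intro n hn
    obtain ⟨-, -, hLP, hPw, -, -, -, hr⟩ := hmem n hn
    set P : ℝ := (Shiu.cutPrime z (n * (m * n + h)) : ℝ) with hPdef
    have hP1 : 1 < P := by linarith
    have hlogP : 0 < Real.log P := Real.log_pos hP1
    have hlogLP : Real.log L₀ < Real.log P := Real.log_lt_log (by linarith) hLP
    have hq0 : 0 ≤ Real.log z / Real.log P := div_nonneg hlogz.le hlogP.le
    have hr_le : (r : ℝ) ≤ Real.log z / Real.log P := by rw [← hr]; exact Nat.floor_le hq0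
    have hr_lt : Real.log z / Real.log P < r + 1 := by rw [← hr]; exact Nat.lt_floor_add_one _
    refine ⟨?_, ?_, ?_, ?_⟩
    · have h2 : (2 : ℝ) ≤ Real.log z / Real.log P := by
        rw [le_div_iff₀ hlogP, hlogzw]
        have := Real.log_le_log (by linarith) hPw
        linarith
      rw [← hr]; exact Nat.le_floor h2
    · rwa [le_div_iff₀ hlogP] at hr_le
    · rwa [div_lt_iff₀ hlogP] at hr_lt
    · have h1 : (r : ℝ) * Real.log L₀ ≤ r * Real.log P :=
        mul_le_mul_of_nonneg_left hlogLP.le (Nat.cast_nonneg r)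
      rw [le_div_iff₀ hlogP] at hr_le
      linarith
  obtain ⟨hr2, -, -, hrL⟩ := hrfacts n₀ hn₀
  have hr0 : (0 : ℝ) < r := by exact_mod_cast (by omega : 0 < r)
  -- the parameters
  have hu0 : 0 < u := Real.rpow_pos_of_pos hz0 _
  have hv0 : 0 < v := Real.rpow_pos_of_pos hz0 _
  have hlogu : Real.log u = Real.log z / (r + 1) := by rw [hu, Real.log_rpow hz0]; ring
  have hlogv : Real.log v = Real.log z / r := by rw [hv, Real.log_rpow hz0]; ring
  have hη0 : 0 ≤ η := by positivity
  have hlogL : 0 < Real.log L₀ := Real.log_pos (by linarith)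
  have hη6 : η ≤ 1 / 6 := by
    rw [hη, div_le_iff₀ hlogz]
    have h1 : K₁ * r * Real.log L₀ ≤ K₁ * Real.log z := by
      rw [mul_assoc]; exact mul_le_mul_of_nonneg_left hrL hK₁0
    have h2 : K₁ * Real.log z ≤ 1 / 6 * Real.log z * Real.log L₀ := by nlinarith
    nlinarith
  have hu2 : 2 ≤ u := by
    have hlog4 : Real.log 4 = 2 * Real.log 2 := by
      rw [show (4 : ℝ) = 2 ^ 2 by norm_num, Real.log_pow]; ring
    have hlogL4 : Real.log 4 ≤ Real.log L₀ := Real.log_le_log (by norm_num) hL₀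
    have hr2' : (2 : ℝ) ≤ r := by exact_mod_cast hr2
    have hl2 := Real.log_pos one_lt_two
    have h0 : (r : ℝ) * (2 * Real.log 2) ≤ Real.log z :=
      le_trans (mul_le_mul_of_nonneg_left (hlog4 ▸ hlogL4) (by positivity)) hrL
    have h1 : ((r : ℝ) + 1) * Real.log 2 ≤ Real.log z := by nlinarith
    have h2 : Real.log 2 ≤ Real.log u := by
      rw [hlogu, le_div_iff₀ (by positivity)]; linarith
    exact (Real.log_le_log_iff (by norm_num) hu0).1 h2
  have hu1 : 1 < u := by linarith
  have huz : u ≤ z ^ (1 / 3 : ℝ) := by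
    refine Real.rpow_le_rpow_of_exponent_le hz1 ?_
    rw [div_le_div_iff₀ (by positivity) (by norm_num)]
    have : (2 : ℝ) ≤ r := by exact_mod_cast hr2
    linarith
  have hv2 : 2 ≤ v := by
    refine hu2.trans (Real.rpow_le_rpow_of_exponent_le hz1 ?_)
    exact div_le_div_of_nonneg_left zero_le_one hr0 (by linarith)
  have hPuv : ∀ n ∈ S, u < (Shiu.cutPrime z (n * (m * n + h)) : ℝ) ∧
      (Shiu.cutPrime z (n * (m * n + h)) : ℝ) ≤ v := by
    intro n hn
    obtain ⟨-, -, hLP, -, -, -, -, -⟩ := hmem n hn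
    obtain ⟨-, hrP, hPr, -⟩ := hrfacts n hn
    set P : ℝ := (Shiu.cutPrime z (n * (m * n + h)) : ℝ)
    have hP0 : 0 < P := by linarith
    constructor
    · have h1 : Real.log u < Real.log P := by rw [hlogu, div_lt_iff₀ (by positivity)]; linarith
      exact (Real.log_lt_log_iff hu0 hP0).1 h1
    · have h1 : Real.log P ≤ Real.log v := by rw [hlogv, le_div_iff₀ hr0]; linarith
      exact (Real.log_le_log_iff hP0 hv0).1 h1
  -- the odd sifting range below `u`
  obtain ⟨hPPdvd, hPPodd, hPPpf, hPPfacts⟩ := oddProd_facts u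
  have hfac : ∀ p ∈ (Nat.primesBelow ⌈u⌉₊).erase 2, 0 ≤ 1 - 2 / (p : ℝ) ∧ 1 - 2 / (p : ℝ) ≤ 1 := by
    intro p hp
    rw [← hPPpf] at hp
    obtain ⟨hpp, hp2, -⟩ := hPPfacts p hp
    have hp3 : (3 : ℝ) ≤ p := by
      exact_mod_cast (Nat.succ_le_of_lt (lt_of_le_of_ne hpp.two_le (Ne.symm hp2)))
    constructor
    · rw [sub_nonneg, div_le_one (by linarith)]; linarith
    · have : 0 ≤ 2 / (p : ℝ) := by positivity
      linarith
  have hV01 : 0 ≤ V ∧ V ≤ 1 :=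
    ⟨Finset.prod_nonneg fun p hp => (hfac p hp).1,
     Finset.prod_le_one (fun p hp => (hfac p hp).1) fun p hp => (hfac p hp).2⟩
  -- the modified weights
  have hfh0 : ∀ n, 0 ≤ fh n := fun n => mul_nonneg (hf0 n) (hψ0 n)
  have hgh0 : ∀ n, 0 ≤ gh n := fun n => mul_nonneg (hg0 n) (hψ0 n)
  have hfh1 : fh 1 = 1 := by simp [hfh, hf1, hψ]
  have hgh1 : gh 1 = 1 := by simp [hgh, hg1, hψ]
  have hfhmul : ∀ a b : ℕ, a.Coprime b → fh (a * b) = fh a * fh b := by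
    intro a b hab
    simp only [hfh, hψ]
    rw [hfmul a b hab, PairShiuLocal.psi_mul_of_coprime hab]; ring
  have hghmul : ∀ a b : ℕ, a.Coprime b → gh (a * b) = gh a * gh b := by
    intro a b hab
    simp only [hgh, hψ]
    rw [hgmul a b hab, PairShiuLocal.psi_mul_of_coprime hab]; ring
  have h2B1 : 1 ≤ 2 * B := by linarith
  have hψpow : ∀ p l : ℕ, p.Prime → ψ (p ^ l) ≤ 2 := fun p l hp => PairShiuLocal.psi_prime_pow_le_two hp l
  have h2pow : ∀ l : ℕ, 1 ≤ l → (2 : ℝ) ≤ 2 ^ l := fun l hl => by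
    calc (2 : ℝ) = 2 ^ 1 := by norm_num
      _ ≤ 2 ^ l := pow_le_pow_right₀ (by norm_num) hl
  have hfhB : ∀ p l : ℕ, p.Prime → 1 ≤ l → fh (p ^ l) ≤ (2 * B) ^ l := by
    intro p l hp hl
    simp only [hfh]
    calc f (p ^ l) * ψ (p ^ l) ≤ B ^ l * 2 :=
          mul_le_mul (hfB p l hp hl) (hψpow p l hp) (hψ0 _) (by positivity)
      _ ≤ B ^ l * 2 ^ l := mul_le_mul_of_nonneg_left (h2pow l hl) (by positivity)
      _ = (2 * B) ^ l := by rw [mul_pow]; ring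
  have hghB : ∀ p l : ℕ, p.Prime → 1 ≤ l → gh (p ^ l) ≤ (2 * B) ^ l := by
    intro p l hp hl
    simp only [hgh]
    calc g (p ^ l) * ψ (p ^ l) ≤ B ^ l * 2 :=
          mul_le_mul (hgB p l hp hl) (hψpow p l hp) (hψ0 _) (by positivity)
      _ ≤ B ^ l * 2 ^ l := mul_le_mul_of_nonneg_left (h2pow l hl) (by positivity)
      _ = (2 * B) ^ l := by rw [mul_pow]; ring
  have hfhÂ : ∀ p a : ℕ, p.Prime → 1 ≤ a → fh (p ^ a) ≤ (2 * Â) * ((p : ℝ) ^ a) ^ (1 / 8 : ℝ) := by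
    intro p a hp ha
    simp only [hfh]
    calc f (p ^ a) * ψ (p ^ a) ≤ (Â * ((p : ℝ) ^ a) ^ (1 / 8 : ℝ)) * 2 :=
          mul_le_mul (hfÂ p a hp ha) (hψpow p a hp) (hψ0 _) (by positivity)
      _ = (2 * Â) * ((p : ℝ) ^ a) ^ (1 / 8 : ℝ) := by ring
  have hghÂ : ∀ p a : ℕ, p.Prime → 1 ≤ a → gh (p ^ a) ≤ (2 * Â) * ((p : ℝ) ^ a) ^ (1 / 8 : ℝ) := by
    intro p a hp ha
    simp only [hgh]
    calc g (p ^ a) * ψ (p ^ a) ≤ (Â * ((p : ℝ) ^ a) ^ (1 / 8 : ℝ)) * 2 :=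
          mul_le_mul (hgÂ p a hp ha) (hψpow p a hp) (hψ0 _) (by positivity)
      _ = (2 * Â) * ((p : ℝ) ^ a) ^ (1 / 8 : ℝ) := by ring
  -- facts about the elements of `S` (part 2: the decomposition)
  have hSfacts : ∀ n ∈ S, n ≠ 0 ∧ m * n + h ≠ 0 ∧ (1 ≤ n ∧ n ≤ N) ∧
      (Shiu.cutPrime z (n * (m * n + h))).Prime ∧
      (pr n).1 * (n / (pr n).1) = n ∧ (pr n).2 * ((m * n + h) / (pr n).2) = m * n + h ∧
      (pr n).1.Coprime (n / (pr n).1) ∧ (pr n).2.Coprime ((m * n + h) / (pr n).2) ∧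
      (∀ p ∈ (n / (pr n).1).primeFactors, u ≤ (p : ℝ)) ∧
      (∀ p ∈ ((m * n + h) / (pr n).2).primeFactors, u ≤ (p : ℝ)) ∧
      ((pr n).1 : ℝ) * (pr n).2 ≤ z ∧ 1 ≤ (pr n).1 ∧ 1 ≤ (pr n).2 ∧
      w < ((pr n).1 : ℝ) * (pr n).2 ∧
      (∀ p ∈ (pr n).1.primeFactors, (p : ℝ) < v) ∧ (∀ p ∈ (pr n).2.primeFactors, (p : ℝ) < v) ∧
      ((hP (pr n).1 : ℕ) : ℝ) ≤ Y ∧ ((hP (pr n).2 : ℕ) : ℝ) ≤ Y := by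
    intro n hn
    obtain ⟨⟨hn1, hnN⟩, hzQ, -, -, hcw, hY1, hY2, -⟩ := hmem n hn
    obtain ⟨huP, hPv⟩ := hPuv n hn
    have hn0 : n ≠ 0 := by omega
    have hL0 : m * n + h ≠ 0 := by omega
    set Qn := n * (m * n + h) with hQn
    have hQ2 : 2 ≤ Qn := by
      have : (4 : ℝ) < (Qn : ℝ) := lt_of_le_of_lt hz4 hzQ
      exact_mod_cast (show (2 : ℝ) ≤ Qn by linarith)
    obtain ⟨hPmem, hcz⟩ := Shiu.cutPrime_mem (n := Qn) (z := z) hQ2 hz1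
    set P := Shiu.cutPrime z Qn with hPdef
    have hPp : P.Prime := Nat.prime_of_mem_primeFactors hPmem
    have hc1 : (pr n).1 = smoothPart P n := rfl
    have hc2 : (pr n).2 = smoothPart P (m * n + h) := rfl
    have hsplit : Shiu.cPart z Qn = (pr n).1 * (pr n).2 := by
      rw [hc1, hc2, Shiu.cPart, hQn]
      exact smoothPart_mul hn0 hL0 _
    -- `hP cᵢ ∣ hP n`, `hP (mn+h)`
    have hdvd1 : hP (pr n).1 ∣ hP n := by
      rw [← Nat.factorization_le_iff_dvd (hPart_ne_zero h _) (hPart_ne_zero h _)]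
      intro p
      rw [factorization_hPart, factorization_hPart]
      split_ifs
      · exact (Nat.factorization_le_iff_dvd (smoothPart_ne_zero _ _) hn0).2 (smoothPart_dvd hn0 _) p
      · exact le_rfl
    have hdvd2 : hP (pr n).2 ∣ hP (m * n + h) := by
      rw [← Nat.factorization_le_iff_dvd (hPart_ne_zero h _) (hPart_ne_zero h _)]
      intro p
      rw [factorization_hPart, factorization_hPart]
      split_ifs
      · exact (Nat.factorization_le_iff_dvd (smoothPart_ne_zero _ _) hL0).2 (smoothPart_dvd hL0 _) p
      · exact le_rfl
    refine ⟨hn0, hL0, ⟨hn1, hnN⟩, hPp, ?_, ?_, ?_, ?_, ?_, ?_, ?_, ?_, ?_, ?_, ?_, ?_, ?_, ?_⟩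
    · rw [hc1]; exact smoothPart_mul_div hn0 P
    · rw [hc2]; exact smoothPart_mul_div hL0 P
    · rw [hc1]; exact coprime_smoothPart_div hn0
    · rw [hc2]; exact coprime_smoothPart_div hL0
    · intro p hp
      rw [hc1] at hp
      have h1 := le_of_prime_dvd_div_smoothPart hn0 (Nat.prime_of_mem_primeFactors hp)
        (Nat.dvd_of_mem_primeFactors hp)
      have h2 : (P : ℝ) ≤ p := by exact_mod_cast h1
      linarith
    · intro p hp
      rw [hc2] at hp
      have h1 := le_of_prime_dvd_div_smoothPart hL0 (Nat.prime_of_mem_primeFactors hp)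
        (Nat.dvd_of_mem_primeFactors hp)
      have h2 : (P : ℝ) ≤ p := by exact_mod_cast h1
      linarith
    · have := hcz; rw [hsplit] at this; exact_mod_cast this
    · exact Nat.one_le_iff_ne_zero.mpr (smoothPart_ne_zero _ _)
    · exact Nat.one_le_iff_ne_zero.mpr (smoothPart_ne_zero _ _)
    · have := hcw; rw [hsplit] at this; exact_mod_cast this
    · intro p hp
      have h1 : p < P := (Nat.mem_smoothNumbers'.1 (smoothPart_mem_smoothNumbers P n)) p
        (Nat.prime_of_mem_primeFactors hp) (Nat.dvd_of_mem_primeFactors hp)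
      exact lt_of_lt_of_le (by exact_mod_cast h1) hPv
    · intro p hp
      have h1 : p < P := (Nat.mem_smoothNumbers'.1 (smoothPart_mem_smoothNumbers P (m * n + h))) p
        (Nat.prime_of_mem_primeFactors hp) (Nat.dvd_of_mem_primeFactors hp)
      exact lt_of_lt_of_le (by exact_mod_cast h1) hPv
    · exact le_trans (by exact_mod_cast Nat.le_of_dvd (Nat.pos_of_ne_zero (hPart_ne_zero h _)) hdvd1) hY1
    · exact le_trans (by exact_mod_cast Nat.le_of_dvd (Nat.pos_of_ne_zero (hPart_ne_zero h _)) hdvd2) hY2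
  -- the pointwise bound
  set EE : ℕ := (r + 1) * M₁ with hEE
  have hpt : ∀ n ∈ S, f n * g (m * n + h) ≤ f (pr n).1 * g (pr n).2 * B ^ (2 * EE) := by
    intro n hn
    obtain ⟨hn0, hL0, ⟨hn1, hnN⟩, -, hcd1, hcd2, hcop1, hcop2, hpr1, hpr2, -⟩ := hSfacts n hn
    set d₁ := n / (pr n).1 with hd₁
    set d₂ := (m * n + h) / (pr n).2 with hd₂
    have hd₁0 : d₁ ≠ 0 := fun h0 => hn0 (by rw [← hcd1, h0, mul_zero])
    have hd₂0 : d₂ ≠ 0 := fun h0 => hL0 (by rw [← hcd2, h0, mul_zero])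
    have hf : f n = f (pr n).1 * f d₁ := by
      conv_lhs => rw [← hcd1]
      exact hfmul _ _ hcop1
    have hg : g (m * n + h) = g (pr n).2 * g d₂ := by
      conv_lhs => rw [← hcd2]
      exact hgmul _ _ hcop2
    have hd₁N : (d₁ : ℝ) ≤ N := by
      have : d₁ ≤ n := Nat.div_le_self n _
      exact_mod_cast this.trans hnN
    have hd₂N : (d₂ : ℝ) ≤ ((m * N + h : ℕ) : ℝ) := by
      have : d₂ ≤ m * n + h := Nat.div_le_self _ _
      have h2 : m * n + h ≤ m * N + h := by nlinarith
      exact_mod_cast this.trans h2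
    have hEEr : ((EE : ℕ) : ℝ) = ((r : ℝ) + 1) * M₁ := by rw [hEE]; push_cast; ring
    have hΩ₁ : Shiu.bigOmega d₁ ≤ EE := by
      have h1 := Shiu.bigOmega_le_div_log hd₁0 hu1 hpr1 hd₁N
      have h2 : Real.log N / Real.log u ≤ EE := by
        rw [hlogu, div_div_eq_mul_div, hEEr]
        calc Real.log N * ((r : ℝ) + 1) / Real.log z = ((r : ℝ) + 1) * (Real.log N / Real.log z) := by ring
          _ ≤ ((r : ℝ) + 1) * M₁ := mul_le_mul_of_nonneg_left hM₁ (by positivity)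
      exact_mod_cast h1.trans h2
    have hΩ₂ : Shiu.bigOmega d₂ ≤ EE := by
      have h1 := Shiu.bigOmega_le_div_log hd₂0 hu1 hpr2 hd₂N
      have h2 : Real.log ((m * N + h : ℕ) : ℝ) / Real.log u ≤ EE := by
        rw [hlogu, div_div_eq_mul_div, hEEr]
        calc Real.log ((m * N + h : ℕ) : ℝ) * ((r : ℝ) + 1) / Real.log z
            = ((r : ℝ) + 1) * (Real.log ((m * N + h : ℕ) : ℝ) / Real.log z) := by ring
          _ ≤ ((r : ℝ) + 1) * M₁ := mul_le_mul_of_nonneg_left hM₂ (by positivity)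
      exact_mod_cast h1.trans h2
    have hfd : f d₁ ≤ B ^ EE :=
      (Shiu.le_pow_bigOmega hf0 hf1 hfmul hfB hd₁0).trans (pow_le_pow_right₀ hB1 hΩ₁)
    have hgd : g d₂ ≤ B ^ EE :=
      (Shiu.le_pow_bigOmega hg0 hg1 hgmul hgB hd₂0).trans (pow_le_pow_right₀ hB1 hΩ₂)
    rw [hf, hg]
    have h1 := hf0 (pr n).1
    have h2 := hg0 (pr n).2
    calc f (pr n).1 * f d₁ * (g (pr n).2 * g d₂) = (f (pr n).1 * g (pr n).2) * (f d₁ * g d₂) := by ring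
      _ ≤ (f (pr n).1 * g (pr n).2) * (B ^ EE * B ^ EE) :=
          mul_le_mul_of_nonneg_left (mul_le_mul hfd hgd (hg0 _) (by positivity)) (mul_nonneg h1 h2)
      _ = f (pr n).1 * g (pr n).2 * B ^ (2 * EE) := by rw [two_mul, pow_add]
  -- the fibres
  have hfibre : ∀ c ∈ T,
      (S.filter (fun n => pr n = c)) ⊆ ((Icc 1 N).filter fun n : ℕ => c.1 ∣ n ∧ c.2 ∣ m * n + h ∧
        (n / c.1).Coprime PP ∧ ((m * n + h) / c.2).Coprime PP) ∧
      ((Icc 1 N).filter fun n : ℕ => c.1 ∣ n ∧ c.2 ∣ m * n + h ∧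
        (n / c.1).Coprime PP ∧ ((m * n + h) / c.2).Coprime PP).Nonempty ∧
      1 ≤ c.1 ∧ 1 ≤ c.2 ∧ ((c.1 : ℝ) * c.2 ≤ z) ∧
      (Nat.gcd (m * c.1) c.2 : ℝ) ≤ Nat.gcd (hP c.1) (hP c.2) ∧
      (∀ p ∈ h.primeFactors, c.1.factorization p = 0 ↔ c.2.factorization p = 0) ∧
      w < (c.1 : ℝ) * c.2 ∧ (∀ p ∈ c.1.primeFactors, (p : ℝ) < v) ∧ (∀ p ∈ c.2.primeFactors, (p : ℝ) < v) ∧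
      ((hP c.1 : ℕ) : ℝ) ≤ Y ∧ ((hP c.2 : ℕ) : ℝ) ≤ Y := by
    intro c hc
    rw [hT, Finset.mem_image] at hc
    obtain ⟨n₁, hn₁S, hn₁c⟩ := hc
    obtain ⟨hn₁0, hL₁0, hn₁I, hP₁, hcd1, hcd2, -, -, hpr1, hpr2, hcz, hc1, hc2, hcw, hv1, hv2, hY1, hY2⟩ :=
      hSfacts n₁ hn₁S
    have hcouple : ∀ p ∈ h.primeFactors, c.1.factorization p = 0 ↔ c.2.factorization p = 0 := by
      intro p hp
      have hpp := Nat.prime_of_mem_primeFactors hp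
      have hph := Nat.dvd_of_mem_primeFactors hp
      have hpm : ¬ p ∣ m := fun hpm => by
        have := Nat.dvd_gcd hpm hph
        rw [hmh.gcd_eq_one] at this
        exact hpp.one_lt.ne' (Nat.dvd_one.mp this)
      rw [← hn₁c]
      change (smoothPart _ n₁).factorization p = 0 ↔ (smoothPart _ (m * n₁ + h)).factorization p = 0
      rw [factorization_smoothPart, factorization_smoothPart]
      split_ifs with hlt
      · exact factorization_eq_zero_iff_lin hpp hph hpm hn₁0
      · exact Iff.rfl
    rw [hn₁c] at hcd1 hcd2 hpr1 hpr2 hcz hc1 hc2 hcw hv1 hv2 hY1 hY2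
    have hsub : (S.filter (fun n => pr n = c)) ⊆ ((Icc 1 N).filter fun n : ℕ => c.1 ∣ n ∧
        c.2 ∣ m * n + h ∧ (n / c.1).Coprime PP ∧ ((m * n + h) / c.2).Coprime PP) := by
      intro n hn
      rw [Finset.mem_filter] at hn
      obtain ⟨hnS, hnc⟩ := hn
      obtain ⟨hn0, hL0, hnI, -, hd1, hd2, -, -, hq1, hq2, -⟩ := hSfacts n hnS
      rw [hnc] at hd1 hd2 hq1 hq2
      rw [Finset.mem_filter, Finset.mem_Icc]
      refine ⟨hnI, ⟨n / c.1, hd1.symm⟩, ⟨(m * n + h) / c.2, hd2.symm⟩, ?_, ?_⟩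
      · exact coprime_oddProd_of_le (fun h0 => hn0 (by rw [← hd1, h0, mul_zero])) hq1
      · exact coprime_oddProd_of_le (fun h0 => hL0 (by rw [← hd2, h0, mul_zero])) hq2
    have hn₁mem : n₁ ∈ S.filter (fun n => pr n = c) := Finset.mem_filter.mpr ⟨hn₁S, hn₁c⟩
    refine ⟨hsub, ⟨n₁, hsub hn₁mem⟩, hc1, hc2, hcz, ?_, hcouple, hcw, hv1, hv2, hY1, hY2⟩
    set G := Nat.gcd (m * c.1) c.2 with hG
    have hc1n : c.1 ∣ n₁ := ⟨n₁ / c.1, hcd1.symm⟩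
    have hc2L : c.2 ∣ m * n₁ + h := ⟨(m * n₁ + h) / c.2, hcd2.symm⟩
    have hGh : G ∣ Nat.gcd n₁ h := by
      have a : G ∣ m * n₁ := (Nat.gcd_dvd_left _ _).trans (mul_dvd_mul_left m hc1n)
      have b : G ∣ m * n₁ + h := (Nat.gcd_dvd_right _ _).trans hc2L
      have hab := Nat.dvd_gcd a b
      rw [show m * n₁ + h = h + 1 * (m * n₁) by ring, Nat.gcd_add_mul_right_right,
        hmh.gcd_mul_left_cancel n₁] at hab
      exact hab
    have hGdh : G ∣ h := hGh.trans (Nat.gcd_dvd_right _ _)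
    have hGm : G.Coprime m := Nat.Coprime.coprime_dvd_left hGdh hmh.symm
    have hGc1 : G ∣ c.1 := hGm.dvd_of_dvd_mul_left (Nat.gcd_dvd_left _ _)
    have hGc2 : G ∣ c.2 := Nat.gcd_dvd_right _ _
    have hGsupp : G.primeFactors ⊆ h.primeFactors := Nat.primeFactors_mono hGdh (by omega)
    have h1 : G ∣ hP c.1 := dvd_hPart_of_dvd (by omega) hGc1 hGsupp
    have h2 : G ∣ hP c.2 := dvd_hPart_of_dvd (by omega) hGc2 hGsupp
    have h4 : G ≤ Nat.gcd (hP c.1) (hP c.2) :=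
      Nat.le_of_dvd (Nat.gcd_pos_of_pos_left _ (Nat.pos_of_ne_zero (hPart_ne_zero h _))) (Nat.dvd_gcd h1 h2)
    exact_mod_cast h4
  -- one fibre
  set W19 : ℝ := u ^ (19 : ℕ) * Real.log u ^ 2 with hW19
  have hone : ∀ c ∈ T, ∑ n ∈ S.filter (fun n => pr n = c), f n * g (m * n + h) ≤
      C₀ * B ^ (2 * EE) * ((N : ℝ) * V * ψh * ψm + z * (ψh * ψm + W19)) *
        (fh c.1 * gh c.2 * (Nat.gcd (hP c.1) (hP c.2) : ℝ) / ((c.1 : ℝ) * c.2)) := by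
    intro c hc
    obtain ⟨hsub, hDne, hc1, hc2, hcz, hGle, -, -, -, -, -, -⟩ := hfibre c hc
    have hcount := hcard N m h c.1 c.2 u PP hu2 hPPdvd hPPodd hm hh hc1 hc2 hDne
    rw [hPPpf] at hcount
    have hE0 : h * m * c.1 * c.2 ≠ 0 := by
      refine Nat.mul_ne_zero (Nat.mul_ne_zero (Nat.mul_ne_zero ?_ ?_) ?_) ?_ <;> omega
    have hcorr : ∏ p ∈ ((Nat.primesBelow ⌈u⌉₊).erase 2).filter (· ∣ h * m * c.1 * c.2),
        (((p : ℝ) - 1) / ((p : ℝ) - 2)) ≤ ψh * ψm * ψ c.1 * ψ c.2 :=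
      (PairShiuLocal.prod_filter_dvd_le_psi (S := (Nat.primesBelow ⌈u⌉₊).erase 2)
        (fun p hp => by rw [← hPPpf] at hp; exact ⟨(hPPfacts p hp).1, (hPPfacts p hp).2.1⟩) hE0).trans
        (PairShiuLocal.psi_mul_four_le h m c.1 c.2)
    have hcorr0 : 0 ≤ ∏ p ∈ ((Nat.primesBelow ⌈u⌉₊).erase 2).filter (· ∣ h * m * c.1 * c.2),
        (((p : ℝ) - 1) / ((p : ℝ) - 2)) := by
      refine Finset.prod_nonneg fun p hp => ?_
      have hp' := (Finset.mem_filter.mp hp).1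
      rw [← hPPpf] at hp'
      exact zero_le_one.trans (PairShiuLocal.psi_factor_bounds (hPPfacts p hp').1 (hPPfacts p hp').2.1).1
    have hGe1 : (1 : ℝ) ≤ Nat.gcd (hP c.1) (hP c.2) := by
      exact_mod_cast Nat.gcd_pos_of_pos_left _ (Nat.pos_of_ne_zero (hPart_ne_zero h _))
    have hcnt : (#((Icc 1 N).filter fun n : ℕ => c.1 ∣ n ∧ c.2 ∣ m * n + h ∧
        (n / c.1).Coprime PP ∧ ((m * n + h) / c.2).Coprime PP) : ℝ) ≤
        C₀ * ((N : ℝ) * Nat.gcd (m * c.1) c.2 / ((c.1 : ℝ) * c.2) + 1) *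
          (V * ∏ p ∈ ((Nat.primesBelow ⌈u⌉₊).erase 2).filter (· ∣ h * m * c.1 * c.2),
            (((p : ℝ) - 1) / ((p : ℝ) - 2))) + C₀ * W19 := by
      have := hcount; rw [hW19]; linarith
    have halg := fibre_algebra_rankin (hf0 c.1) (hg0 c.2) (hψ1 c.1) (hψ1 c.2) hψh0 hψm0 hV01.1 hV01.2
      (Nat.cast_nonneg N) (Nat.cast_nonneg _) hGle hGe1 (by exact_mod_cast hc1) (by exact_mod_cast hc2)
      hcz hcorr0 hcorr hC₀.le (by positivity) hcnt (show 0 ≤ B ^ (2 * EE) by positivity)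
    calc ∑ n ∈ S.filter (fun n => pr n = c), f n * g (m * n + h)
        ≤ ∑ n ∈ S.filter (fun n => pr n = c), f c.1 * g c.2 * B ^ (2 * EE) := by
          refine Finset.sum_le_sum fun n hn => ?_
          obtain ⟨hnS, hnc⟩ := Finset.mem_filter.mp hn
          have := hpt n hnS
          rwa [hnc] at this
      _ = #(S.filter (fun n => pr n = c)) * (f c.1 * g c.2 * B ^ (2 * EE)) := by
          rw [Finset.sum_const, nsmul_eq_mul]
      _ ≤ #((Icc 1 N).filter fun n : ℕ => c.1 ∣ n ∧ c.2 ∣ m * n + h ∧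
            (n / c.1).Coprime PP ∧ ((m * n + h) / c.2).Coprime PP) * (f c.1 * g c.2 * B ^ (2 * EE)) := by
          have h1 := hf0 c.1; have h2 := hg0 c.2
          gcongr
      _ = f c.1 * g c.2 * B ^ (2 * EE) * #((Icc 1 N).filter fun n : ℕ => c.1 ∣ n ∧ c.2 ∣ m * n + h ∧
            (n / c.1).Coprime PP ∧ ((m * n + h) / c.2).Coprime PP) := by ring
      _ ≤ _ := halg
  -- the main sum, with Rankin's trick
  set W₀ : ℝ := w / (Y * Y) with hW₀
  have hW₀pos : 0 < W₀ := by positivity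
  have hmainT : ∑ c ∈ T, fh c.1 * gh c.2 * (Nat.gcd (hP c.1) (hP c.2) : ℝ) / ((c.1 : ℝ) * c.2) ≤
      W₀ ^ (-η) * (Δ * (Real.exp (∑ p ∈ Shiu.primesBelowNotDvd v 1, fh p / p +
            2 * B * η * v ^ η * (Real.log v + Real.log 4) + Shiu.K₅ A (2 * B)) *
          Real.exp (∑ p ∈ Shiu.primesBelowNotDvd v 1, gh p / p +
            2 * B * η * v ^ η * (Real.log v + Real.log 4) + Shiu.K₅ A (2 * B)))) := by
    have h2Â : 0 ≤ 2 * Â := by linarith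
    have hTT : ∀ c ∈ T, 1 ≤ c.1 ∧ 1 ≤ c.2 ∧
        (∀ p ∈ h.primeFactors, c.1.factorization p = 0 ↔ c.2.factorization p = 0) ∧
        (∀ p ∈ c.1.primeFactors, (p : ℝ) < v) ∧ (∀ p ∈ c.2.primeFactors, (p : ℝ) < v) ∧
        W₀ < ((c.1 / hP c.1 : ℕ) : ℝ) * ((c.2 / hP c.2 : ℕ) : ℝ) := by
      intro c hc
      obtain ⟨-, -, hc1, hc2, -, -, hcouple, hcw, hv1, hv2, hY1, hY2⟩ := hfibre c hc
      refine ⟨hc1, hc2, hcouple, hv1, hv2, ?_⟩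
      -- `c₁c₂ > w` and `hP cᵢ ≤ Y`
      have hc10 : c.1 ≠ 0 := by omega
      have hc20 : c.2 ≠ 0 := by omega
      have hd1 := hPart_mul_div hc10 h
      have hd2 := hPart_mul_div hc20 h
      have he1 : (0 : ℝ) < hP c.1 := by exact_mod_cast Nat.pos_of_ne_zero (hPart_ne_zero h _)
      have he2 : (0 : ℝ) < hP c.2 := by exact_mod_cast Nat.pos_of_ne_zero (hPart_ne_zero h _)
      have hc1r : (c.1 : ℝ) = (hP c.1 : ℝ) * ((c.1 / hP c.1 : ℕ) : ℝ) := by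
        rw [← Nat.cast_mul]; exact_mod_cast hd1.symm
      have hc2r : (c.2 : ℝ) = (hP c.2 : ℝ) * ((c.2 / hP c.2 : ℕ) : ℝ) := by
        rw [← Nat.cast_mul]; exact_mod_cast hd2.symm
      have hu1 : 0 ≤ ((c.1 / hP c.1 : ℕ) : ℝ) := Nat.cast_nonneg _
      have hu2 : 0 ≤ ((c.2 / hP c.2 : ℕ) : ℝ) := Nat.cast_nonneg _
      rw [hW₀, div_lt_iff₀ (by positivity)]
      calc w < (c.1 : ℝ) * c.2 := hcw
        _ = ((hP c.1 : ℝ) * (hP c.2 : ℝ)) * (((c.1 / hP c.1 : ℕ) : ℝ) * ((c.2 / hP c.2 : ℕ) : ℝ)) := by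
            rw [hc1r, hc2r]; ring
        _ ≤ (Y * Y) * (((c.1 / hP c.1 : ℕ) : ℝ) * ((c.2 / hP c.2 : ℕ) : ℝ)) :=
            mul_le_mul_of_nonneg_right (mul_le_mul hY1 hY2 he2.le (by linarith)) (mul_nonneg hu1 hu2)
        _ = _ := by ring
    have hmain := mainSum_rankin_le hfh0 hgh0 hfh1 hgh1 hfhmul hghmul h2B1 hfhB hghB
      (fun n hn => hfA n hn) (fun n hn => hgA n hn) h2Â hfhÂ hghÂ (show h ≠ 0 by omega)
      hη0 hη6 hv2 hW₀pos T hTT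
    refine hmain.trans (mul_le_mul_of_nonneg_left ?_ (by positivity))
    refine mul_le_mul_of_nonneg_right ?_ (by positivity)
    rw [hΔ, show (160 : ℝ) * (2 * Â) ^ 2 = 640 * Â ^ 2 by ring]
    refine mul_le_mul_of_nonneg_left ?_ (by positivity)
    refine Finset.prod_le_prod (fun p _ => by have := hfh0 p; have := hgh0 p; positivity) fun p hp => ?_
    have hpp := Nat.prime_of_mem_primeFactors hp
    have hp0 : (0 : ℝ) < p := by exact_mod_cast hpp.pos
    have hψp : ψ p ≤ 2 := by have := hψpow p 1 hpp; rwa [pow_one] at this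
    have : fh p * gh p ≤ 4 * f p * g p := by
      simp only [hfh, hgh]
      have hf := hf0 p; have hg := hg0 p; have hψ0p := hψ0 p
      calc f p * ψ p * (g p * ψ p) = (f p * g p) * (ψ p * ψ p) := by ring
        _ ≤ (f p * g p) * (2 * 2) :=
            mul_le_mul_of_nonneg_left (mul_le_mul hψp hψp hψ0p (by norm_num)) (mul_nonneg hf hg)
        _ = 4 * f p * g p := by ring
    have := div_le_div_of_nonneg_right this hp0.le
    linarith
  -- the Rankin saving and the exponents
  have hW₀η : W₀ ^ (-η) ≤ Real.exp (-(K₁ * r / 4)) := by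
    have hY0 : 0 < Y := by linarith
    rw [hW₀, Real.div_rpow hw0.le (by positivity), Real.rpow_neg hw0.le, Real.rpow_neg (by positivity)]
    rw [div_eq_mul_inv, inv_inv]
    -- `(Y²)^η ≤ w^{η/2}` and `w^{-η} w^{η/2} = w^{-η/2} = e^{-K₁ r/4}`
    have hY2 : (Y * Y) ^ η ≤ w ^ (η / 2) := by
      have h1 : Y * Y ≤ w ^ (1 / 2 : ℝ) := by
        calc Y * Y ≤ w ^ (1 / 4 : ℝ) * w ^ (1 / 4 : ℝ) := mul_le_mul hYw hYw hY0.le (by positivity)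
          _ = w ^ (1 / 2 : ℝ) := by rw [← Real.rpow_add hw0]; norm_num
      calc (Y * Y) ^ η ≤ (w ^ (1 / 2 : ℝ)) ^ η := Real.rpow_le_rpow (by positivity) h1 hη0
        _ = w ^ (η / 2) := by rw [← Real.rpow_mul hw0.le]; ring_nf
    have hwη : (w ^ η)⁻¹ * w ^ (η / 2) = Real.exp (-(K₁ * r / 4)) := by
      rw [← Real.rpow_neg hw0.le, ← Real.rpow_add hw0, Real.rpow_def_of_pos hw0]
      congr 1
      have : Real.log w = Real.log z / 2 := by rw [hlogzw]; ring
      rw [this, hη]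
      field_simp
      ring
    calc (w ^ η)⁻¹ * (Y * Y) ^ η ≤ (w ^ η)⁻¹ * w ^ (η / 2) :=
          mul_le_mul_of_nonneg_left hY2 (by positivity)
      _ = Real.exp (-(K₁ * r / 4)) := hwη
  have hexpf : ∀ {F : ℕ → ℝ}, (∀ n, 0 ≤ F n) →
      Real.exp (∑ p ∈ Shiu.primesBelowNotDvd v 1, F p / p +
        2 * B * η * v ^ η * (Real.log v + Real.log 4) + Shiu.K₅ A (2 * B)) ≤
      Real.exp (∑ p ∈ Shiu.primesBelowNotDvd ((⌊z⌋₊ : ℝ) + 1) 1, F p / p +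
        2 * B * Real.exp K₁ * (K₁ + 1) + Shiu.K₅ A (2 * B)) := by
    intro F hF0
    refine Real.exp_le_exp.2 ?_
    have hvz : v ≤ z := by
      conv_rhs => rw [← Real.rpow_one z]
      refine Real.rpow_le_rpow_of_exponent_le hz1 ?_
      rw [div_le_one hr0]
      have : (2 : ℝ) ≤ r := by exact_mod_cast hr2
      linarith
    have hE1 : ∑ p ∈ Shiu.primesBelowNotDvd v 1, F p / p ≤
        ∑ p ∈ Shiu.primesBelowNotDvd ((⌊z⌋₊ : ℝ) + 1) 1, F p / p := by
      refine Finset.sum_le_sum_of_subset_of_nonneg (fun p hp => ?_) (fun p _ _ => by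
        exact div_nonneg (hF0 p) (Nat.cast_nonneg p))
      rw [Shiu.mem_primesBelowNotDvd] at hp ⊢
      refine ⟨hp.1, ?_, hp.2.2⟩
      have h1 : (p : ℝ) ≤ z := by linarith [hp.2.1]
      have h2 : p ≤ ⌊z⌋₊ := Nat.le_floor h1
      have h3 : ((p : ℕ) : ℝ) ≤ (⌊z⌋₊ : ℝ) := by exact_mod_cast h2
      linarith
    have hvη : v ^ η = Real.exp K₁ := by
      rw [Real.rpow_def_of_pos hv0, hlogv, hη]
      congr 1
      field_simp
    have hlog4 : η * Real.log 4 ≤ 1 := by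
      have h4 : Real.log 4 ≤ 3 := by
        have := Real.log_le_sub_one_of_pos (by norm_num : (0 : ℝ) < 4); linarith
      have : η * Real.log 4 ≤ 1 / 6 * 3 :=
        mul_le_mul hη6 h4 (Real.log_nonneg (by norm_num)) (by norm_num)
      linarith
    have hηv : η * Real.log v = K₁ := by rw [hlogv, hη]; field_simp
    have hE2 : 2 * B * η * v ^ η * (Real.log v + Real.log 4) ≤ 2 * B * Real.exp K₁ * (K₁ + 1) := by
      have : 2 * B * η * v ^ η * (Real.log v + Real.log 4) =
          2 * B * Real.exp K₁ * (η * Real.log v + η * Real.log 4) := by rw [hvη]; ring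
      rw [this, hηv]
      refine mul_le_mul_of_nonneg_left (by linarith) (by positivity)
    linarith
  have hΛf' := hexpf hfh0
  have hΛg' := hexpf hgh0
  -- the saving `B^{2EE} e^{-K₁ r/2} = B^{2M₁}/4^r`
  have hid : B ^ (2 * EE) * Real.exp (-(K₁ * r / 4)) = B ^ (2 * M₁) / 4 ^ r := by
    have h0 := Shiu.pow_mul_exp_neg_eq hB0 (2 * M₁) r
    rw [show (r + 1) * (2 * M₁) = 2 * EE by rw [hEE]; ring] at h0
    rw [show -(K₁ * r / 4) = -((2 * ((2 * M₁ : ℕ) : ℝ) * Real.log B + 4 * Real.log 2) * r / 2) by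
      rw [hK₁]; push_cast; ring]
    exact h0
  -- assemble
  have hmaps : ∀ n ∈ S, pr n ∈ T := fun n hn => Finset.mem_image_of_mem pr hn
  rw [← Finset.sum_fiberwise_of_maps_to hmaps]
  have hKfac : 0 ≤ (N : ℝ) * V * ψh * ψm + z * (ψh * ψm + W19) := by
    have := hV01.1; positivity
  have hK : 0 ≤ C₀ * B ^ (2 * EE) * ((N : ℝ) * V * ψh * ψm + z * (ψh * ψm + W19)) := by positivity
  have hMf0 : 0 ≤ Real.exp (∑ p ∈ Shiu.primesBelowNotDvd v 1, fh p / p +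
      2 * B * η * v ^ η * (Real.log v + Real.log 4) + Shiu.K₅ A (2 * B)) := (Real.exp_pos _).le
  have hMg0 : 0 ≤ Real.exp (∑ p ∈ Shiu.primesBelowNotDvd v 1, gh p / p +
      2 * B * η * v ^ η * (Real.log v + Real.log 4) + Shiu.K₅ A (2 * B)) := (Real.exp_pos _).le
  calc ∑ c ∈ T, ∑ n ∈ S.filter (fun n => pr n = c), f n * g (m * n + h)
      ≤ ∑ c ∈ T, C₀ * B ^ (2 * EE) * ((N : ℝ) * V * ψh * ψm + z * (ψh * ψm + W19)) *
          (fh c.1 * gh c.2 * (Nat.gcd (hP c.1) (hP c.2) : ℝ) / ((c.1 : ℝ) * c.2)) := Finset.sum_le_sum hone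
    _ = C₀ * B ^ (2 * EE) * ((N : ℝ) * V * ψh * ψm + z * (ψh * ψm + W19)) *
          ∑ c ∈ T, fh c.1 * gh c.2 * (Nat.gcd (hP c.1) (hP c.2) : ℝ) / ((c.1 : ℝ) * c.2) := by
        rw [← Finset.mul_sum]
    _ ≤ C₀ * B ^ (2 * EE) * ((N : ℝ) * V * ψh * ψm + z * (ψh * ψm + W19)) *
          (Real.exp (-(K₁ * r / 4)) * (Δ * (Λf * Λg))) := by
        refine mul_le_mul_of_nonneg_left (hmainT.trans ?_) hK
        refine mul_le_mul hW₀η (mul_le_mul_of_nonneg_left ?_ hΔ0) (by positivity) (by positivity)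
        exact mul_le_mul hΛf' hΛg' hMg0 (hMf0.trans hΛf')
    _ = C₀ * (B ^ (2 * EE) * Real.exp (-(K₁ * r / 4))) *
          ((N : ℝ) * V * ψh * ψm + z * (ψh * ψm + W19)) * (Δ * (Λf * Λg)) := by ring
    _ = _ := by rw [hid]


/-! ### The odd sifting density and the sum over `r` -/

/-- **The odd sifting density**: `∏_{2 < p < u} (1 − 2/p) ≤ 4 / log² u` for `u ≥ 2`
(`1 − 2/p ≤ (1 − 1/p)²` and Mertens' elementary `∏_{p<u}(1 − 1/p) ≤ 1/log u`). [folklore] -/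
theorem oddDensity_le {u : ℝ} (hu : 2 ≤ u) :
    ∏ p ∈ (Nat.primesBelow ⌈u⌉₊).erase 2, (1 - 2 / (p : ℝ)) ≤ 4 / Real.log u ^ 2 := by
  set S := Nat.primesBelow ⌈u⌉₊ with hS
  have hprime : ∀ p ∈ S, p.Prime := fun p hp => (Nat.mem_primesBelow.mp hp).2
  have hu1 : 1 < u := by linarith
  have hlog : 0 < Real.log u := Real.log_pos hu1
  -- Mertens
  have hM : Real.log u ≤ ∏ p ∈ S, (1 - (p : ℝ)⁻¹)⁻¹ := by
    have hM1 : 1 ≤ ⌈u⌉₊ := Nat.one_le_iff_ne_zero.mpr (Nat.pos_iff_ne_zero.mp (Nat.ceil_pos.mpr (by linarith)))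
    calc Real.log u ≤ Real.log (⌈u⌉₊ : ℕ) := Real.log_le_log (by linarith) (Nat.le_ceil u)
      _ ≤ _ := BombieriSieve.log_le_prod_primesBelow_inv hM1
  have hfacpos : ∀ p ∈ S, 0 < 1 - (p : ℝ)⁻¹ := by
    intro p hp
    have hp2 : (2 : ℝ) ≤ p := by exact_mod_cast (hprime p hp).two_le
    have : (p : ℝ)⁻¹ ≤ 1 / 2 := by rw [inv_eq_one_div]; exact div_le_div_of_nonneg_left (by norm_num) (by norm_num) hp2
    linarith
  have hPpos : 0 < ∏ p ∈ S, (1 - (p : ℝ)⁻¹) := Finset.prod_pos hfacpos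
  have hP1 : (∏ p ∈ S, (1 - (p : ℝ)⁻¹)) ≤ 1 / Real.log u := by
    rw [Finset.prod_inv_distrib] at hM
    rw [le_div_iff₀ hlog]
    calc (∏ p ∈ S, (1 - (p : ℝ)⁻¹)) * Real.log u ≤ (∏ p ∈ S, (1 - (p : ℝ)⁻¹)) * (∏ p ∈ S, (1 - (p : ℝ)⁻¹))⁻¹ :=
          mul_le_mul_of_nonneg_left hM hPpos.le
      _ = 1 := mul_inv_cancel₀ hPpos.ne'
  -- remove the prime `2`
  have hS' : ∏ p ∈ S.erase 2, (1 - (p : ℝ)⁻¹) ≤ 2 * ∏ p ∈ S, (1 - (p : ℝ)⁻¹) := by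
    by_cases h2 : 2 ∈ S
    · rw [← Finset.mul_prod_erase S _ h2]
      norm_num
      have h0 : 0 ≤ ∏ p ∈ S.erase 2, (1 - (p : ℝ)⁻¹) :=
        Finset.prod_nonneg fun p hp => (hfacpos p (Finset.mem_of_mem_erase hp)).le
      linarith
    · rw [Finset.erase_eq_of_notMem h2]
      exact le_mul_of_one_le_left hPpos.le (by norm_num)
  -- termwise
  have hfac : ∀ p ∈ S.erase 2, (1 - 2 / (p : ℝ)) ≤ (1 - (p : ℝ)⁻¹) ^ 2 ∧ 0 ≤ 1 - 2 / (p : ℝ) := by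
    intro p hp
    obtain ⟨hp2, hpS⟩ := Finset.mem_erase.mp hp
    have hpp := hprime p hpS
    have hp3 : (3 : ℝ) ≤ p := by
      exact_mod_cast (Nat.succ_le_of_lt (lt_of_le_of_ne hpp.two_le (Ne.symm hp2)))
    have hp0 : (0 : ℝ) < p := by linarith
    constructor
    · have : (1 - (p : ℝ)⁻¹) ^ 2 = 1 - 2 / p + ((p : ℝ) ^ 2)⁻¹ := by field_simp; ring
      rw [this]
      have : 0 ≤ ((p : ℝ) ^ 2)⁻¹ := by positivity
      linarith
    · rw [sub_nonneg, div_le_one hp0]; linarith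
  calc ∏ p ∈ S.erase 2, (1 - 2 / (p : ℝ)) ≤ ∏ p ∈ S.erase 2, (1 - (p : ℝ)⁻¹) ^ 2 :=
        Finset.prod_le_prod (fun p hp => (hfac p hp).2) fun p hp => (hfac p hp).1
    _ = (∏ p ∈ S.erase 2, (1 - (p : ℝ)⁻¹)) ^ 2 := Finset.prod_pow _ _ _
    _ ≤ (2 * ∏ p ∈ S, (1 - (p : ℝ)⁻¹)) ^ 2 := by
        refine pow_le_pow_left₀ (Finset.prod_nonneg fun p hp => ?_) hS' 2
        exact (hfacpos p (Finset.mem_of_mem_erase hp)).le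
    _ ≤ (2 * (1 / Real.log u)) ^ 2 := by
        refine pow_le_pow_left₀ (by positivity) (mul_le_mul_of_nonneg_left hP1 (by norm_num)) 2
    _ = 4 / Real.log u ^ 2 := by field_simp; norm_num

/-- `∑_{r < R} 3/2^r ≤ 6`. [folklore] -/
theorem sum_three_div_two_pow_le (R : ℕ) : ∑ r ∈ Finset.range R, (3 : ℝ) / 2 ^ r ≤ 6 := by
  have : ∑ r ∈ Finset.range R, (3 : ℝ) / 2 ^ r = 3 * ∑ r ∈ Finset.range R, (1 / 2 : ℝ) ^ r := by
    rw [Finset.mul_sum]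
    refine Finset.sum_congr rfl fun r _ => ?_
    rw [div_pow, one_pow]; ring
  rw [this, geom_sum_eq (by norm_num)]
  have h : (0 : ℝ) < (1 / 2 : ℝ) ^ R := by positivity
  have : ((1 / 2 : ℝ) ^ R - 1) / (1 / 2 - 1) = 2 * (1 - (1 / 2 : ℝ) ^ R) := by field_simp; ring
  rw [this]
  nlinarith


set_option maxHeartbeats 1600000 in
/-- **Class IV** (sum of `class_IV_r_le` over `r`, with `∏_{2<p<u_r}(1−2/p) ≤ 4(r+1)²/log² z`,
`u_r ≤ z^{1/3}`, `(r+1)²/4^r ≤ 3/2^r` and `∑_r 3/2^r ≤ 6`):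
`∑_{IV} f(n)g(mn+h) ≤ C B^{2M₁} (N ψ(h)ψ(m)/log² z + z(ψ(h)ψ(m) + z^{19/3} log² z)) ·
e^{640Â²}∏_{p∣h}(1+4f(p)g(p)/p) Λ_f Λ_g`. [cite: Shiu1980, §5 (∑_IV)] -/
theorem class_IV_le : ∃ C : ℝ, 0 < C ∧
    ∀ {f g : ℕ → ℝ}, (∀ n, 0 ≤ f n) → (∀ n, 0 ≤ g n) → f 1 = 1 → g 1 = 1 →
    (∀ a b : ℕ, a.Coprime b → f (a * b) = f a * f b) →
    (∀ a b : ℕ, a.Coprime b → g (a * b) = g a * g b) →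
    ∀ {B : ℝ}, 1 ≤ B → (∀ p l : ℕ, p.Prime → 1 ≤ l → f (p ^ l) ≤ B ^ l) →
    (∀ p l : ℕ, p.Prime → 1 ≤ l → g (p ^ l) ≤ B ^ l) →
    ∀ {A : ℝ}, (∀ n : ℕ, 1 ≤ n →
      f n * (∏ p ∈ n.primeFactors.erase 2, (((p : ℝ) - 1) / ((p : ℝ) - 2))) ≤ A * (n : ℝ) ^ (1 / 6 : ℝ)) →
    (∀ n : ℕ, 1 ≤ n →
      g n * (∏ p ∈ n.primeFactors.erase 2, (((p : ℝ) - 1) / ((p : ℝ) - 2))) ≤ A * (n : ℝ) ^ (1 / 6 : ℝ)) →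
    ∀ {Â : ℝ}, 0 ≤ Â → (∀ p a : ℕ, p.Prime → 1 ≤ a → f (p ^ a) ≤ Â * ((p : ℝ) ^ a) ^ (1 / 8 : ℝ)) →
    (∀ p a : ℕ, p.Prime → 1 ≤ a → g (p ^ a) ≤ Â * ((p : ℝ) ^ a) ^ (1 / 8 : ℝ)) →
    ∀ {m h N : ℕ}, 1 ≤ m → 1 ≤ h → m.Coprime h →
    ∀ {w L₀ Y : ℝ}, 2 ≤ w → 4 ≤ L₀ → 1 ≤ Y → Y ≤ w ^ (1 / 4 : ℝ) → ∀ {M₁ : ℕ}, Real.log N / Real.log (w * w) ≤ M₁ →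
    Real.log ((m * N + h : ℕ) : ℝ) / Real.log (w * w) ≤ M₁ →
    6 * (8 * M₁ * Real.log B + 8 * Real.log 2) ≤ Real.log L₀ →
    ∑ n ∈ (Icc 1 N).filter (fun n : ℕ => w * w < ((n * (m * n + h) : ℕ) : ℝ) ∧
        L₀ < (Shiu.cutPrime (w * w) (n * (m * n + h)) : ℝ) ∧
        (Shiu.cutPrime (w * w) (n * (m * n + h)) : ℝ) ≤ w ∧
        w < (Shiu.cPart (w * w) (n * (m * n + h)) : ℝ) ∧
        ((∏ q ∈ h.primeFactors, q ^ n.factorization q : ℕ) : ℝ) ≤ Y ∧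
        ((∏ q ∈ h.primeFactors, q ^ (m * n + h).factorization q : ℕ) : ℝ) ≤ Y),
        f n * g (m * n + h) ≤
      C * B ^ (2 * M₁) *
        ((N : ℝ) * (∏ p ∈ h.primeFactors.erase 2, (((p : ℝ) - 1) / ((p : ℝ) - 2))) *
            (∏ p ∈ m.primeFactors.erase 2, (((p : ℝ) - 1) / ((p : ℝ) - 2))) / Real.log (w * w) ^ 2 +
          (w * w) * ((∏ p ∈ h.primeFactors.erase 2, (((p : ℝ) - 1) / ((p : ℝ) - 2))) *
            (∏ p ∈ m.primeFactors.erase 2, (((p : ℝ) - 1) / ((p : ℝ) - 2))) +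
            ((w * w) ^ (1 / 3 : ℝ)) ^ (19 : ℕ) * Real.log (w * w) ^ 2)) *
        ((Real.exp (640 * Â ^ 2) * ∏ p ∈ h.primeFactors, (1 + 4 * f p * g p / p)) *
          (Real.exp (∑ p ∈ Shiu.primesBelowNotDvd ((⌊w * w⌋₊ : ℝ) + 1) 1,
              f p * (∏ q ∈ p.primeFactors.erase 2, (((q : ℝ) - 1) / ((q : ℝ) - 2))) / p +
              2 * B * Real.exp (8 * M₁ * Real.log B + 8 * Real.log 2) *
                ((8 * M₁ * Real.log B + 8 * Real.log 2) + 1) + Shiu.K₅ A (2 * B)) *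
           Real.exp (∑ p ∈ Shiu.primesBelowNotDvd ((⌊w * w⌋₊ : ℝ) + 1) 1,
              g p * (∏ q ∈ p.primeFactors.erase 2, (((q : ℝ) - 1) / ((q : ℝ) - 2))) / p +
              2 * B * Real.exp (8 * M₁ * Real.log B + 8 * Real.log 2) *
                ((8 * M₁ * Real.log B + 8 * Real.log 2) + 1) + Shiu.K₅ A (2 * B)))) := by
  obtain ⟨C, hC, hr⟩ := class_IV_r_le
  refine ⟨24 * C, by positivity, ?_⟩
  intro f g hf0 hg0 hf1 hg1 hfmul hgmul B hB1 hfB hgB A hfA hgA Â hÂ hfÂ hgÂ m h N hm hh hmh w L₀ Y hw hL₀ hY hYw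
    M₁ hM₁ hM₂ hLK
  -- notation
  set ψh : ℝ := ∏ p ∈ h.primeFactors.erase 2, (((p : ℝ) - 1) / ((p : ℝ) - 2)) with hψh
  set ψm : ℝ := ∏ p ∈ m.primeFactors.erase 2, (((p : ℝ) - 1) / ((p : ℝ) - 2)) with hψm
  set z : ℝ := w * w with hz
  set K₁ : ℝ := 8 * M₁ * Real.log B + 8 * Real.log 2 with hK₁
  set hP : ℕ → ℕ := fun k => ∏ q ∈ h.primeFactors, q ^ k.factorization q with hhP
  set FF : ℝ := (Real.exp (640 * Â ^ 2) * ∏ p ∈ h.primeFactors, (1 + 4 * f p * g p / p)) *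
          (Real.exp (∑ p ∈ Shiu.primesBelowNotDvd ((⌊z⌋₊ : ℝ) + 1) 1,
              f p * (∏ q ∈ p.primeFactors.erase 2, (((q : ℝ) - 1) / ((q : ℝ) - 2))) / p +
              2 * B * Real.exp K₁ * (K₁ + 1) + Shiu.K₅ A (2 * B)) *
           Real.exp (∑ p ∈ Shiu.primesBelowNotDvd ((⌊z⌋₊ : ℝ) + 1) 1,
              g p * (∏ q ∈ p.primeFactors.erase 2, (((q : ℝ) - 1) / ((q : ℝ) - 2))) / p +
              2 * B * Real.exp K₁ * (K₁ + 1) + Shiu.K₅ A (2 * B))) with hFF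
  set S := (Icc 1 N).filter (fun n : ℕ => z < ((n * (m * n + h) : ℕ) : ℝ) ∧
        L₀ < (Shiu.cutPrime z (n * (m * n + h)) : ℝ) ∧
        (Shiu.cutPrime z (n * (m * n + h)) : ℝ) ≤ w ∧
        w < (Shiu.cPart z (n * (m * n + h)) : ℝ) ∧
        ((hP n : ℕ) : ℝ) ≤ Y ∧ ((hP (m * n + h) : ℕ) : ℝ) ≤ Y) with hS
  set rfun : ℕ → ℕ := fun n => ⌊Real.log z / Real.log (Shiu.cutPrime z (n * (m * n + h)))⌋₊ with hrfun
  set R : ℕ := ⌊Real.log z / Real.log 2⌋₊ with hR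
  set Kmain : ℝ := 4 * ((N : ℝ) * ψh * ψm / Real.log z ^ 2) +
      z * (ψh * ψm + (z ^ (1 / 3 : ℝ)) ^ (19 : ℕ) * Real.log z ^ 2) with hKmain
  -- positivity
  have hw0 : 0 < w := by linarith
  have hz4 : 4 ≤ z := by rw [hz]; nlinarith
  have hz1 : 1 ≤ z := by linarith
  have hz0 : 0 < z := by linarith
  have hlogz : 0 < Real.log z := Real.log_pos (by linarith)
  have hlogzw : Real.log z = 2 * Real.log w := by rw [hz, Real.log_mul hw0.ne' hw0.ne']; ring
  have hψh0 : 0 ≤ ψh := PairShiuLocal.psi_nonneg h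
  have hψm0 : 0 ≤ ψm := PairShiuLocal.psi_nonneg m
  have hFF0 : 0 ≤ FF := by
    rw [hFF]
    refine mul_nonneg (mul_nonneg (Real.exp_pos _).le
      (Finset.prod_nonneg fun p _ => by have := hf0 p; have := hg0 p; positivity)) (by positivity)
  have hKmain0 : 0 ≤ Kmain := by positivity
  -- the fibres over `r`
  have hmaps : ∀ n ∈ S, rfun n ∈ Finset.range (R + 1) := by
    intro n hn
    rw [hS, Finset.mem_filter] at hn
    obtain ⟨-, -, hLP, -⟩ := hn
    rw [Finset.mem_range, Nat.lt_succ_iff, hrfun, hR]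
    refine Nat.floor_le_floor (div_le_div_of_nonneg_left hlogz.le (Real.log_pos one_lt_two) ?_)
    exact Real.log_le_log (by norm_num) (by linarith)
  rw [← Finset.sum_fiberwise_of_maps_to hmaps]
  have hfib : ∀ r ∈ Finset.range (R + 1), ∑ n ∈ S.filter (fun n => rfun n = r), f n * g (m * n + h) ≤
      C * B ^ (2 * M₁) * (3 / 2 ^ r) * Kmain * FF := by
    intro r _
    have hSr : S.filter (fun n => rfun n = r) = (Icc 1 N).filter (fun n : ℕ => z < ((n * (m * n + h) : ℕ) : ℝ) ∧
        L₀ < (Shiu.cutPrime z (n * (m * n + h)) : ℝ) ∧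
        (Shiu.cutPrime z (n * (m * n + h)) : ℝ) ≤ w ∧
        w < (Shiu.cPart z (n * (m * n + h)) : ℝ) ∧
        ((hP n : ℕ) : ℝ) ≤ Y ∧ ((hP (m * n + h) : ℕ) : ℝ) ≤ Y ∧ rfun n = r) := by
      rw [hS, Finset.filter_filter]
      simp only [and_assoc]
    rw [hSr]
    set u : ℝ := z ^ (1 / ((r : ℝ) + 1)) with hu
    have hu0 : 0 < u := Real.rpow_pos_of_pos hz0 _
    have hlogu : Real.log u = Real.log z / (r + 1) := by rw [hu, Real.log_rpow hz0]; ring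
    have hRHS0 : 0 ≤ C * B ^ (2 * M₁) * (3 / 2 ^ r) * Kmain * FF := by positivity
    by_cases hTe : (Icc 1 N).filter (fun n : ℕ => z < ((n * (m * n + h) : ℕ) : ℝ) ∧
        L₀ < (Shiu.cutPrime z (n * (m * n + h)) : ℝ) ∧
        (Shiu.cutPrime z (n * (m * n + h)) : ℝ) ≤ w ∧
        w < (Shiu.cPart z (n * (m * n + h)) : ℝ) ∧
        ((hP n : ℕ) : ℝ) ≤ Y ∧ ((hP (m * n + h) : ℕ) : ℝ) ≤ Y ∧ rfun n = r) = ∅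
    · rw [hTe, Finset.sum_empty]
      exact hRHS0
    obtain ⟨n₀, hn₀⟩ := Finset.nonempty_iff_ne_empty.2 hTe
    have hbound := hr hf0 hg0 hf1 hg1 hfmul hgmul hB1 hfB hgB hfA hgA hÂ hfÂ hgÂ hm hh hmh hw hL₀ hY hYw hM₁ hM₂ hLK r
    refine hbound.trans ?_
    -- `r ≥ 2`
    rw [Finset.mem_filter] at hn₀
    obtain ⟨-, -, hLP, hPw, -, -, -, hr0⟩ := hn₀
    have hP1 : (1 : ℝ) < (Shiu.cutPrime z (n₀ * (m * n₀ + h)) : ℝ) := by linarith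
    have hlogP : 0 < Real.log (Shiu.cutPrime z (n₀ * (m * n₀ + h)) : ℝ) := Real.log_pos hP1
    have hr2 : 2 ≤ r := by
      have h2 : (2 : ℝ) ≤ Real.log z / Real.log (Shiu.cutPrime z (n₀ * (m * n₀ + h)) : ℝ) := by
        rw [le_div_iff₀ hlogP, hlogzw]
        have := Real.log_le_log (by linarith) hPw
        linarith
      rw [← hr0]; exact Nat.le_floor h2
    have hr2' : (2 : ℝ) ≤ r := by exact_mod_cast hr2
    -- `u ≥ 2`, `u ≤ z^{1/3}`, `0 ≤ log u ≤ log z`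
    have huz : u ≤ z ^ (1 / 3 : ℝ) := by
      refine Real.rpow_le_rpow_of_exponent_le hz1 ?_
      rw [div_le_div_iff₀ (by positivity) (by norm_num)]
      linarith
    have hlogu0 : 0 ≤ Real.log u := by rw [hlogu]; positivity
    have hloguz : Real.log u ≤ Real.log z := by
      rw [hlogu, div_le_iff₀ (by positivity)]
      nlinarith
    have hu2 : 2 ≤ u := by
      -- `(r+1) log 2 ≤ log z`: from `rfun n₀ = r`, `log z < (r+1) log P` is not needed; use `r ≤ R`-free
      -- argument: `log u = log z/(r+1)` and `r + 1 ≤ log z / log P + 1 ≤ ...`; simplest: `u > P^{...}`.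
      -- We use `log z / log P < r + 1` and `P ≥ L₀ ≥ 4 ≥ 2`.
      have hr_lt : Real.log z / Real.log (Shiu.cutPrime z (n₀ * (m * n₀ + h)) : ℝ) < r + 1 := by
        rw [← hr0]; exact Nat.lt_floor_add_one _
      rw [div_lt_iff₀ hlogP] at hr_lt
      have hlog2P : Real.log 2 ≤ Real.log (Shiu.cutPrime z (n₀ * (m * n₀ + h)) : ℝ) :=
        Real.log_le_log (by norm_num) (by linarith)
      have h1 : Real.log 2 ≤ Real.log u := by
        rw [hlogu, le_div_iff₀ (by positivity)]
        -- `(r+1) log 2 ≤ (r+1) log P`, and `log z < (r+1) log P` gives only an upper bound;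
        -- instead use `r log P ≤ log z` (floor) and `log 2 ≤ log P/... `: `(r+1) log 2 ≤ r log P` for `r ≥ 2`
        have hr_le : (r : ℝ) * Real.log (Shiu.cutPrime z (n₀ * (m * n₀ + h)) : ℝ) ≤ Real.log z := by
          have h0 : (r : ℝ) ≤ Real.log z / Real.log (Shiu.cutPrime z (n₀ * (m * n₀ + h)) : ℝ) := by
            rw [← hr0]; exact Nat.floor_le (div_nonneg hlogz.le hlogP.le)
          rwa [le_div_iff₀ hlogP] at h0
        have hlog4P : 2 * Real.log 2 ≤ Real.log (Shiu.cutPrime z (n₀ * (m * n₀ + h)) : ℝ) := by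
          have : Real.log 4 = 2 * Real.log 2 := by
            rw [show (4 : ℝ) = 2 ^ 2 by norm_num, Real.log_pow]; ring
          rw [← this]; exact Real.log_le_log (by norm_num) (by linarith)
        nlinarith [Real.log_pos one_lt_two]
      exact (Real.log_le_log_iff (by norm_num) hu0).1 h1
    -- the density and the junk
    have hV := oddDensity_le hu2
    have hV' : ∏ p ∈ (Nat.primesBelow ⌈u⌉₊).erase 2, (1 - 2 / (p : ℝ)) ≤ 4 * ((r : ℝ) + 1) ^ 2 / Real.log z ^ 2 := by
      rw [hlogu] at hV
      have : 4 / (Real.log z / ((r : ℝ) + 1)) ^ 2 = 4 * ((r : ℝ) + 1) ^ 2 / Real.log z ^ 2 := by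
        field_simp
      rwa [this] at hV
    have hjunk : u ^ (19 : ℕ) * Real.log u ^ 2 ≤ (z ^ (1 / 3 : ℝ)) ^ (19 : ℕ) * Real.log z ^ 2 := by
      refine mul_le_mul (pow_le_pow_left₀ hu0.le huz 19) (pow_le_pow_left₀ hlogu0 hloguz 2)
        (by positivity) (by positivity)
    have hsq : ((r : ℝ) + 1) ^ 2 / 4 ^ r ≤ 3 / 2 ^ r := by
      rw [div_le_div_iff₀ (by positivity) (by positivity)]
      have h1 := succ_sq_le r
      have h2 : (4 : ℝ) ^ r = 2 ^ r * 2 ^ r := by rw [← mul_pow]; norm_num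
      rw [h2]
      have h3 : (0 : ℝ) < 2 ^ r := by positivity
      nlinarith
    have hone : (1 : ℝ) / 4 ^ r ≤ 3 / 2 ^ r := by
      rw [div_le_div_iff₀ (by positivity) (by positivity)]
      have h2 : (4 : ℝ) ^ r = 2 ^ r * 2 ^ r := by rw [← mul_pow]; norm_num
      have h3 : (1 : ℝ) ≤ 2 ^ r := one_le_pow₀ (by norm_num)
      have h4 : (0 : ℝ) < 2 ^ r := by positivity
      nlinarith
    -- combine
    have hmain : B ^ (2 * M₁) / 4 ^ r * ((N : ℝ) * (∏ p ∈ (Nat.primesBelow ⌈u⌉₊).erase 2, (1 - 2 / (p : ℝ))) * ψh * ψm +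
        z * (ψh * ψm + u ^ (19 : ℕ) * Real.log u ^ 2)) ≤ B ^ (2 * M₁) * (3 / 2 ^ r) * Kmain := by
      have hB2 : 0 ≤ B ^ (2 * M₁) := by positivity
      have hX : 0 ≤ (N : ℝ) * ψh * ψm / Real.log z ^ 2 := by positivity
      have hJ : 0 ≤ z * (ψh * ψm + (z ^ (1 / 3 : ℝ)) ^ (19 : ℕ) * Real.log z ^ 2) := by positivity
      have h1 : (N : ℝ) * (∏ p ∈ (Nat.primesBelow ⌈u⌉₊).erase 2, (1 - 2 / (p : ℝ))) * ψh * ψm ≤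
          ((r : ℝ) + 1) ^ 2 * (4 * ((N : ℝ) * ψh * ψm / Real.log z ^ 2)) := by
        calc (N : ℝ) * (∏ p ∈ (Nat.primesBelow ⌈u⌉₊).erase 2, (1 - 2 / (p : ℝ))) * ψh * ψm
            = (∏ p ∈ (Nat.primesBelow ⌈u⌉₊).erase 2, (1 - 2 / (p : ℝ))) * ((N : ℝ) * ψh * ψm) := by ring
          _ ≤ (4 * ((r : ℝ) + 1) ^ 2 / Real.log z ^ 2) * ((N : ℝ) * ψh * ψm) :=
              mul_le_mul_of_nonneg_right hV' (by positivity)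
          _ = ((r : ℝ) + 1) ^ 2 * (4 * ((N : ℝ) * ψh * ψm / Real.log z ^ 2)) := by ring
      have h2 : z * (ψh * ψm + u ^ (19 : ℕ) * Real.log u ^ 2) ≤
          z * (ψh * ψm + (z ^ (1 / 3 : ℝ)) ^ (19 : ℕ) * Real.log z ^ 2) :=
        mul_le_mul_of_nonneg_left (by linarith) hz0.le
      calc B ^ (2 * M₁) / 4 ^ r * ((N : ℝ) * (∏ p ∈ (Nat.primesBelow ⌈u⌉₊).erase 2, (1 - 2 / (p : ℝ))) * ψh * ψm +
            z * (ψh * ψm + u ^ (19 : ℕ) * Real.log u ^ 2))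
          ≤ B ^ (2 * M₁) / 4 ^ r * (((r : ℝ) + 1) ^ 2 * (4 * ((N : ℝ) * ψh * ψm / Real.log z ^ 2)) +
            z * (ψh * ψm + (z ^ (1 / 3 : ℝ)) ^ (19 : ℕ) * Real.log z ^ 2)) :=
            mul_le_mul_of_nonneg_left (add_le_add h1 h2) (by positivity)
        _ = B ^ (2 * M₁) * ((((r : ℝ) + 1) ^ 2 / 4 ^ r) * (4 * ((N : ℝ) * ψh * ψm / Real.log z ^ 2)) +
            (1 / 4 ^ r) * (z * (ψh * ψm + (z ^ (1 / 3 : ℝ)) ^ (19 : ℕ) * Real.log z ^ 2))) := by ring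
        _ ≤ B ^ (2 * M₁) * ((3 / 2 ^ r) * (4 * ((N : ℝ) * ψh * ψm / Real.log z ^ 2)) +
            (3 / 2 ^ r) * (z * (ψh * ψm + (z ^ (1 / 3 : ℝ)) ^ (19 : ℕ) * Real.log z ^ 2))) := by
            refine mul_le_mul_of_nonneg_left (add_le_add ?_ ?_) hB2
            · exact mul_le_mul_of_nonneg_right hsq (by positivity)
            · exact mul_le_mul_of_nonneg_right hone hJ
        _ = B ^ (2 * M₁) * (3 / 2 ^ r) * Kmain := by rw [hKmain]; ring
    calc C * (B ^ (2 * M₁) / 4 ^ r) * ((N : ℝ) * (∏ p ∈ (Nat.primesBelow ⌈u⌉₊).erase 2, (1 - 2 / (p : ℝ))) * ψh * ψm +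
          z * (ψh * ψm + u ^ (19 : ℕ) * Real.log u ^ 2)) * FF
        = C * (B ^ (2 * M₁) / 4 ^ r * ((N : ℝ) * (∏ p ∈ (Nat.primesBelow ⌈u⌉₊).erase 2, (1 - 2 / (p : ℝ))) * ψh * ψm +
          z * (ψh * ψm + u ^ (19 : ℕ) * Real.log u ^ 2))) * FF := by ring
      _ ≤ C * (B ^ (2 * M₁) * (3 / 2 ^ r) * Kmain) * FF :=
          mul_le_mul_of_nonneg_right (mul_le_mul_of_nonneg_left hmain hC.le) hFF0
      _ = _ := by ring
  -- sum over `r`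
  calc ∑ r ∈ Finset.range (R + 1), ∑ n ∈ S.filter (fun n => rfun n = r), f n * g (m * n + h)
      ≤ ∑ r ∈ Finset.range (R + 1), C * B ^ (2 * M₁) * (3 / 2 ^ r) * Kmain * FF := Finset.sum_le_sum hfib
    _ = C * B ^ (2 * M₁) * Kmain * FF * ∑ r ∈ Finset.range (R + 1), (3 : ℝ) / 2 ^ r := by
        rw [Finset.mul_sum]
        refine Finset.sum_congr rfl fun r _ => ?_
        ring
    _ ≤ C * B ^ (2 * M₁) * Kmain * FF * 6 :=
        mul_le_mul_of_nonneg_left (sum_three_div_two_pow_le _) (by positivity)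
    _ ≤ 24 * C * B ^ (2 * M₁) * ((N : ℝ) * ψh * ψm / Real.log z ^ 2 +
          z * (ψh * ψm + (z ^ (1 / 3 : ℝ)) ^ (19 : ℕ) * Real.log z ^ 2)) * FF := by
        rw [hKmain]
        have hX : 0 ≤ (N : ℝ) * ψh * ψm / Real.log z ^ 2 := by positivity
        have hJ : 0 ≤ z * (ψh * ψm + (z ^ (1 / 3 : ℝ)) ^ (19 : ℕ) * Real.log z ^ 2) := by positivity
        have hCB : 0 ≤ C * B ^ (2 * M₁) * FF := by positivity
        nlinarith
    _ = _ := by rw [hFF]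

end PairShiu

end Literature.NumberTheory.Sieve
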